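import Literature.Barriers.CriticalPhenomena.LaceExpansionSAWIdentity
import Literature.Probability.FitznerVanDerHofstad2017.SrwISeedTail
import Literature.Probability.FitznerVanDerHofstad2017.SrwLawBridges
import Literature.Probability.FitznerVanDerHofstad2017.SrwTaylorRemainderKernel
import Literature.Probability.FitznerVanDerHofstad2017.SrwFarNodeBound
import Literature.Probability.RandomPlanarGeometry.SAWCount
import Literature.Probability.RandomPlanarGeometry.SAWFisherSykesBound
import HarnessLib

/-!
# Kesten's expansion made effective: `2d − 1 − 1/(2d) − 9/(4d²) − 22780/d³ ≤ μ(ℤ^d) < 2d − 1 − 1/(2d) + 1/(2d²)`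
# for every `d ≥ 5`, by the Hara–Slade–Sokal loop erasure at COUNT level (`k = 0` and `k = 1`)

SKETCH (lane «pcv-sawmu», designer a-idea-2 g39, DOORS-DAY7 door 2/2b/2d; ed.4 = ed.3 with cite tags on every public declaration; supersedes `SAWLoopErasureLowerBound.lean`).
The tree proves Kesten's expansion only ineffectively (`SAW.Zd.abs_connectiveConstant_sub_le`,
`abs_connectiveConstant_sub_two_le`: `∃ K, ∀ᶠ d, |μ − (2d − 1 − 1/(2d))| ≤ K/d²`); this file gives EXPLICIT lower bounds at
every `d`, from scratch on the combinatorial side and BY NAME from the lace build on the analytic side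
(`C₀(0,0;1/2d) = G_d = srwI d 1 0 0`, `hasSum_srwLaw_srwI_one`, `abs_srwI_sub_taylor_le_kernel`, `srwLaw_spAct`).

AS PRINTED (Hara–Slade–Sokal, J. Stat. Phys. 72 (1993) 479–517 = arXiv:hep-lat/9302003, §2.3): "(2.29) becomes
`μ ≥ 2d / C₀(0,0;1/2d)` [`k = 0`] (2.31)", and for `k = 1` the loops at the pivots `j ≥ 1` may be required to avoid the
previous pivot, "`μ ≥ 2d / C₀^{\{e\}}(0,0;1/2d)` (2.32) … `C₀^{\{e\}}(0,0;z) = 2 − 1/C₀(0,0;z)` (2.33)"; §6.2 (6.17): Kesten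
(1964) proved "`μ ≥ 2d − 1 − 1/(2d) + O(d⁻²)` … albeit without good control of the error term". Mechanism: every simple
random walk is its (chronological) loop erasure — a self-avoiding walk — decorated with closed loops at the pivots.

Contents (all `d`-generic; `u_σ = count d σ 0`, `β = 1/(2d)`):
* `closedAvoid A σ`, `nbLoops d σ = w_σ := max_s #{closed σ-loops avoiding e_s}` (the max avoids a symmetry proof);
  first-step exclusion `#closedAvoid {e_s} (σ+1) + count d σ (−e_s) ≤ u_{σ+1}`.
* `avoid_card_step` — THE DECORATION STEP, parametric in the loop numbers: split an `A`-avoiding walk at its LAST visit to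
  `0` (fibres `card_lastFiber_le`, `card_lastFiber_self_le`), recurse on the tail which avoids `(A ∪ {0}) − e_s`, prepend
  `s` to its SAWs (`sum_card_sawAvoid_shift_le`). Corollaries: `avoid_card_le` (`k = 0`, loops counted by `u`),
  `avoid_card_le_nb` (obstacle containing a neighbour of `0`: loops counted by `w`), and with no obstacle
  `pow_le_sum_count_mul_loopTuples₂ : (2d)ⁿ ≤ Σ_{m ≤ n} c_m T^{u,w}_{m+1}(n − m)` (first loop `u`, later loops `w`).
* generating functions with finite sums: `sum_loopTuples_mul_pow_le`, `sum_loopTuples₂_mul_pow_le`,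
  `sum_count_mul_pow_le_srwI` (`Σ_{j ≤ K} u_j β^j ≤ G_d`), and `sum_nbLoops_mul_pow_le`
  (`Σ_{j ≤ K} w_j β^j ≤ G_d − β(G_d − 1)`, from `p_{σ+1}(0) = p_σ(e)` (`srwLaw_succ_zero_eq_stepVec`, symmetry
  `srwLaw_stepVec_eq` via `srwLaw_spAct`/`srwLaw_neg`) and `Σ_σ p_σ(e) = G_d − 1` (`hasSum_srwLaw_stepVec`)).
* `succ_le_sum_count_mul_pow_of` + `two_mul_div_le_connectiveConstant_of` — the limit argument (`c_m^{1/m} → μ`,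
  `tendsto_count_rpow`): `N + 1 ≤ Σ_{m ≤ N} c_m β^m C W^m ∀ N ⇒ 2d/W ≤ μ`.
* RESULTS: `two_mul_div_srwI_le_connectiveConstant : 2d / G_d ≤ μ(ℤ^d)` (`d ≥ 3`, HSS (2.31) AS PRINTED);
  `two_mul_div_nb_le_connectiveConstant : 2d / (G_d − β(G_d − 1)) ≤ μ(ℤ^d)` (`d ≥ 3`; the first-step form of (2.32), equal
  to the printed `2d/(2 − 1/G_d)` to second order); with the explicit enclosures `srwI_one_zero_zero_le_explicit`
  (`R = 5`) / `srwI_one_zero_zero_le_explicit₇` (`R = 7`: `G_d ≤ 1 + 1/(2d) + 3/(4d²) + 15/(8d³) + 11392/d⁴`, `d ≥ 5`):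
  `kesten_first_order_effective : 2d − 1 − 1/d − 3300/d² ≤ μ(ℤ^d)` and
  **`kesten_second_order_effective : 2d − 1 − 1/(2d) − 9/(4d²) − 22780/d³ ≤ μ(ℤ^d)`** for EVERY `d ≥ 5`
  (truth: `μ = 2d − 1 − 1/(2d) − 3/(4d²) − 2/d³ − …`; HSS (6.20): the exact `(0,1)` bound expands as `… − s − 4s² − …`, this
  first-step version as `… − s − 9s²`; the lane's elementary envelope `2d − 5/4 − log d < μ` (SAWAllDimensionsEnvelope) is
  the better lower bound for `d ≤ 19`, this one from `d = 20` on).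
* §8, the CEILING and the TWO-SIDED form: `connectiveConstant_lt_fisherSykes_closed_form : μ < 2d − 1 − 1/(2d+2)` (`d ≥ 2`,
  from the in-tree memory-4 cubic `connectiveConstant_cube_le_fisherSykes`), hence `connectiveConstant_lt_kesten_upper :
  μ < 2d − 1 − 1/(2d) + 1/(2d²)`; **`abs_connectiveConstant_sub_kesten_le : |μ − (2d − 1 − 1/(2d))| ≤ 9/(4d²) + 22780/d³`**
  and **`abs_connectiveConstant_sub_two_le_effective : |μ − (2d − 1 − 1/(2d))| ≤ 4559/d²`** for EVERY `d ≥ 5` — the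
  in-tree `abs_connectiveConstant_sub_two_le` (`∃ K, ∀ᶠ d`) with an explicit constant and threshold.
-/

noncomputable section

open Finset Filter Topology
open scoped BigOperators Nat

namespace Literature.Probability.FitznerVanDerHofstad2017

open Literature.Barriers.CriticalPhenomena Literature.Barriers.CriticalPhenomena.LongRangePhi4

/-! ### The analytic input: `G_d ≤ 1 + 1/(2d) + 3/(4d²) + 1632/d³` (`d ≥ 5`), by name from the lace build -/

/-- **`G_d = srwI d 1 0 0 ≤ 1 + 1/(2d) + 3/(4d²) + 1632/d³` for `d ≥ 5`** (explicit, uniform in `d`): the anchor-free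
enclosure `abs_srwI_sub_taylor_le_kernel` (`n = l = 0`, `R = 5`), Gaussian domination `srwLaw_two_mul_zero_le`
(`p₂(0) ≤ 1/(2d)`, `p₄(0) ≤ 3/(4d²)`), parity `srwLaw_odd_zero`, and `128·√(11‼)/(2d)³ ≤ 1632/d³` (`√10395 < 102`).
Truth: `G_d = 1 + s + 3s² + 12s³ + …`, `s = 1/(2d)` (HSS93 Table 7: `G₅ = 1.156308`). [cite: HaraSladeSokal1993, Appendix A, eq. (A.17) (I_{1,0}(0) = 1 + s + 3s² + 12s³ + 60s⁴ + 355s⁵ + O(s⁶), s = 1/(2d)); lane enclosure on the lace build's Taylor kernel] -/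
theorem srwI_one_zero_zero_le_explicit {d : ℕ} (hd : 5 ≤ d) :
    srwI d 1 0 0 ≤ 1 + 1 / (2 * (d : ℝ)) + 3 / (4 * (d : ℝ) ^ 2) + 1632 / (d : ℝ) ^ 3 := by
  have hd1 : 1 ≤ d := by omega
  have hd0 : (0 : ℝ) < d := by exact_mod_cast (show 0 < d by omega)
  have h := abs_srwI_sub_taylor_le_kernel (d := d) (n := 0) (l := 0) (R := 5) (by omega)
    (by decide) (0 : Fin d → ℤ)
  -- the Taylor part: `Σ_{i<6} C(i,0) p_i(0) = p₀ + p₂ + p₄`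
  have hp0 : srwLaw d 0 (0 : Fin d → ℤ) = 1 := by rw [srwLaw_zero_apply, if_pos rfl]
  have hp1 : srwLaw d 1 (0 : Fin d → ℤ) = 0 := by simpa using srwLaw_odd_zero (d := d) 0
  have hp3 : srwLaw d 3 (0 : Fin d → ℤ) = 0 := by simpa using srwLaw_odd_zero (d := d) 1
  have hp5 : srwLaw d 5 (0 : Fin d → ℤ) = 0 := by simpa using srwLaw_odd_zero (d := d) 2
  have hp2 : srwLaw d 2 (0 : Fin d → ℤ) ≤ 1 / (2 * (d : ℝ)) := by
    have := srwLaw_two_mul_zero_le hd1 1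
    norm_num [Nat.doubleFactorial] at this
    simpa [one_div] using this
  have hp4 : srwLaw d 4 (0 : Fin d → ℤ) ≤ 3 / (4 * (d : ℝ) ^ 2) := by
    have := srwLaw_two_mul_zero_le hd1 2
    norm_num [Nat.doubleFactorial] at this
    have e : (2 * (d : ℝ)) ^ 2 = 4 * (d : ℝ) ^ 2 := by ring
    rw [e] at this
    exact this
  have hsum : ∑ i ∈ range (5 + 1), (((i + 0).choose 0 : ℕ) : ℝ) * srwLaw d (0 + i) 0 =
      1 + srwLaw d 2 0 + srwLaw d 4 0 := by
    simp only [Finset.sum_range_succ, Finset.sum_range_zero, Nat.add_zero, Nat.choose_zero_right, Nat.cast_one,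
      one_mul, Nat.zero_add, hp0, hp1, hp3, hp5]
    ring
  -- the remainder: `C(5,0) · √(11‼/(2d)⁶) · 2⁷ ≤ 1632/d³`
  have hrem : ∑ t ∈ range (0 + 1), (((5 + t).choose t : ℕ) : ℝ) *
      (Real.sqrt ((((2 * (0 + 5 + 1) - 1)‼ : ℕ) : ℝ) / (2 * (d : ℝ)) ^ (0 + 5 + 1)) *
        (2 : ℝ) ^ (6 * (0 + 1 - t) + 1)) ≤ 1632 / (d : ℝ) ^ 3 := by
    have h11 : (((2 * (0 + 5 + 1) - 1)‼ : ℕ) : ℝ) = 10395 := by norm_num [Nat.doubleFactorial]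
    simp only [Finset.sum_range_succ, Finset.sum_range_zero, zero_add, Nat.add_zero, Nat.choose_zero_right,
      Nat.cast_one, one_mul, h11]
    norm_num
    -- goal: √10395 / √((2d)^6) * 128 ≤ 1632 / d^3
    have hs6 : Real.sqrt ((2 * (d : ℝ)) ^ 6) = (2 * (d : ℝ)) ^ 3 := by
      rw [show (2 * (d : ℝ)) ^ 6 = ((2 * (d : ℝ)) ^ 3) ^ 2 by ring, Real.sqrt_sq (by positivity)]
    have hs1 : Real.sqrt 10395 ≤ 102 := by
      rw [show (102 : ℝ) = Real.sqrt (102 ^ 2) by rw [Real.sqrt_sq (by norm_num)]]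
      exact Real.sqrt_le_sqrt (by norm_num)
    have hs0 : 0 ≤ Real.sqrt 10395 := Real.sqrt_nonneg _
    rw [hs6, div_mul_eq_mul_div, div_le_div_iff₀ (by positivity) (by positivity)]
    have hd3 : (0 : ℝ) < (d : ℝ) ^ 3 := by positivity
    nlinarith [mul_le_mul_of_nonneg_right hs1 hd3.le]
  have hmain := (abs_sub_le_iff.1 h).1
  rw [hsum] at hmain
  linarith


/-- **`G_d ≤ 1 + 1/(2d) + 3/(4d²) + 15/(8d³) + 11392/d⁴` for `d ≥ 5`** (the same enclosure with `R = 7`: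
`p₆(0) ≤ 15/(8d³)`, remainder `128·√(15‼)/(2d)⁴ ≤ 11392/d⁴` since `√2027025 < 1424`). [cite: HaraSladeSokal1993, Appendix A, eq. (A.17) (I_{1,0}(0) = 1 + s + 3s² + 12s³ + …; here an upper enclosure with the s³ coefficient relaxed to 15); lane enclosure on the lace build's Taylor kernel] -/
theorem srwI_one_zero_zero_le_explicit₇ {d : ℕ} (hd : 5 ≤ d) :
    srwI d 1 0 0 ≤ 1 + 1 / (2 * (d : ℝ)) + 3 / (4 * (d : ℝ) ^ 2) + 15 / (8 * (d : ℝ) ^ 3) + 11392 / (d : ℝ) ^ 4 := by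
  have hd1 : 1 ≤ d := by omega
  have hd0 : (0 : ℝ) < d := by exact_mod_cast (show 0 < d by omega)
  have h := abs_srwI_sub_taylor_le_kernel (d := d) (n := 0) (l := 0) (R := 7) (by omega)
    (by decide) (0 : Fin d → ℤ)
  have hp0 : srwLaw d 0 (0 : Fin d → ℤ) = 1 := by rw [srwLaw_zero_apply, if_pos rfl]
  have hp1 : srwLaw d 1 (0 : Fin d → ℤ) = 0 := by simpa using srwLaw_odd_zero (d := d) 0
  have hp3 : srwLaw d 3 (0 : Fin d → ℤ) = 0 := by simpa using srwLaw_odd_zero (d := d) 1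
  have hp5 : srwLaw d 5 (0 : Fin d → ℤ) = 0 := by simpa using srwLaw_odd_zero (d := d) 2
  have hp7 : srwLaw d 7 (0 : Fin d → ℤ) = 0 := by simpa using srwLaw_odd_zero (d := d) 3
  have hp2 : srwLaw d 2 (0 : Fin d → ℤ) ≤ 1 / (2 * (d : ℝ)) := by
    have := srwLaw_two_mul_zero_le hd1 1
    norm_num [Nat.doubleFactorial] at this
    simpa [one_div] using this
  have hp4 : srwLaw d 4 (0 : Fin d → ℤ) ≤ 3 / (4 * (d : ℝ) ^ 2) := by
    have := srwLaw_two_mul_zero_le hd1 2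
    norm_num [Nat.doubleFactorial] at this
    have e : (2 * (d : ℝ)) ^ 2 = 4 * (d : ℝ) ^ 2 := by ring
    rw [e] at this
    exact this
  have hp6 : srwLaw d 6 (0 : Fin d → ℤ) ≤ 15 / (8 * (d : ℝ) ^ 3) := by
    have := srwLaw_two_mul_zero_le hd1 3
    norm_num [Nat.doubleFactorial] at this
    have e : (2 * (d : ℝ)) ^ 3 = 8 * (d : ℝ) ^ 3 := by ring
    rw [e] at this
    exact this
  have hsum : ∑ i ∈ range (7 + 1), (((i + 0).choose 0 : ℕ) : ℝ) * srwLaw d (0 + i) 0 =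
      1 + srwLaw d 2 0 + srwLaw d 4 0 + srwLaw d 6 0 := by
    simp only [Finset.sum_range_succ, Finset.sum_range_zero, Nat.add_zero, Nat.choose_zero_right, Nat.cast_one,
      one_mul, Nat.zero_add, hp0, hp1, hp3, hp5, hp7]
    ring
  have hrem : ∑ t ∈ range (0 + 1), (((7 + t).choose t : ℕ) : ℝ) *
      (Real.sqrt ((((2 * (0 + 7 + 1) - 1)‼ : ℕ) : ℝ) / (2 * (d : ℝ)) ^ (0 + 7 + 1)) *
        (2 : ℝ) ^ (6 * (0 + 1 - t) + 1)) ≤ 11392 / (d : ℝ) ^ 4 := by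
    have h15 : (((2 * (0 + 7 + 1) - 1)‼ : ℕ) : ℝ) = 2027025 := by norm_num [Nat.doubleFactorial]
    simp only [Finset.sum_range_succ, Finset.sum_range_zero, zero_add, Nat.add_zero, Nat.choose_zero_right,
      Nat.cast_one, one_mul, h15]
    norm_num
    have hs8 : Real.sqrt ((2 * (d : ℝ)) ^ 8) = (2 * (d : ℝ)) ^ 4 := by
      rw [show (2 * (d : ℝ)) ^ 8 = ((2 * (d : ℝ)) ^ 4) ^ 2 by ring, Real.sqrt_sq (by positivity)]
    have hs1 : Real.sqrt 2027025 ≤ 1424 := by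
      rw [show (1424 : ℝ) = Real.sqrt (1424 ^ 2) by rw [Real.sqrt_sq (by norm_num)]]
      exact Real.sqrt_le_sqrt (by norm_num)
    have hs0 : 0 ≤ Real.sqrt 2027025 := Real.sqrt_nonneg _
    rw [hs8, div_mul_eq_mul_div, div_le_div_iff₀ (by positivity) (by positivity)]
    have hd4 : (0 : ℝ) < (d : ℝ) ^ 4 := by positivity
    nlinarith [mul_le_mul_of_nonneg_right hs1 hd4.le]
  have hmain := (abs_sub_le_iff.1 h).1
  rw [hsum] at hmain
  linarith

/-! ### Symmetry of the return probabilities at the neighbours of the origin; `Σ_n p_n(e) = G_d − 1` -/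

open Literature.Probability.LatticeModels Literature.Probability.LatticeModels.SRW in
/-- `p_n(±e_j) = p_n(e_{j'})`: the step distribution is invariant under signed coordinate permutations
(`srwLaw_spAct`, `srwLaw_neg`). [cite: HaraSladeSokal1993, Appendix A, eq. (A.17)-(A.18) (I_{1,0}(e₁) = s + 3s² + 12s³ + … = I_{1,0}(0) − 1); lane plumbing on the lace build's srwLaw] -/
theorem srwLaw_stepVec_eq {d : ℕ} (hd : 1 ≤ d) (n : ℕ) (s s' : Dir d) :
    srwLaw d n (stepVec s) = srwLaw d n (stepVec s') := by
  -- reduce both to `Pi.single j 1`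
  have hred : ∀ v : Dir d, srwLaw d n (stepVec v) = srwLaw d n (Pi.single v.1 1) := by
    intro v
    unfold stepVec
    cases v.2
    · simp only [Bool.false_eq_true, if_false]
      exact srwLaw_neg hd n _
    · simp only [if_true]
  rw [hred s, hred s']
  -- transposition of the coordinates `s.1`, `s'.1`
  have h := srwLaw_spAct (d := d) (Equiv.swap s.1 s'.1, fun _ => 1) n (Pi.single s.1 1)
  have hact : spAct ((Equiv.swap s.1 s'.1, fun _ => 1) : SgnPermPair d) (Pi.single s.1 1) = Pi.single s'.1 1 := by
    funext i
    rw [spAct_apply]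
    simp only [Units.val_one, one_mul]
    by_cases hi : i = s'.1
    · subst hi
      rw [Equiv.swap_apply_right, Pi.single_eq_same, Pi.single_eq_same]
    · rw [Pi.single_eq_of_ne hi]
      by_cases hi' : i = s.1
      · subst hi'
        rw [Equiv.swap_apply_left, Pi.single_eq_of_ne (Ne.symm hi)]
      · rw [Equiv.swap_apply_of_ne_of_ne hi' hi, Pi.single_eq_of_ne hi']
  rw [hact] at h
  exact h.symm

open Literature.Probability.LatticeModels Literature.Probability.LatticeModels.SRW in
/-- `p_{n+1}(0) = p_n(e)` for every unit vector `e` (one step of the recursion plus symmetry). [cite: HaraSladeSokal1993, Appendix A, eq. (A.17)-(A.18) (I_{1,0}(e₁) = s + 3s² + 12s³ + … = I_{1,0}(0) − 1); lane plumbing on the lace build's srwLaw] -/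
theorem srwLaw_succ_zero_eq_stepVec {d : ℕ} (hd : 1 ≤ d) (n : ℕ) (s : Dir d) :
    srwLaw d (n + 1) 0 = srwLaw d n (stepVec s) := by
  rw [srwLaw_succ_apply]
  have hterm : ∀ j : Fin d, srwLaw d n ((0 : Site d) + Pi.single j 1) + srwLaw d n ((0 : Site d) - Pi.single j 1) =
      2 * srwLaw d n (stepVec s) := by
    intro j
    have h1 : srwLaw d n ((0 : Site d) + Pi.single j 1) = srwLaw d n (stepVec s) := by
      rw [zero_add, show (Pi.single j 1 : Site d) = stepVec ((j, true) : Dir d) by simp [stepVec]]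
      exact srwLaw_stepVec_eq hd n _ _
    have h2 : srwLaw d n ((0 : Site d) - Pi.single j 1) = srwLaw d n (stepVec s) := by
      rw [zero_sub, show (-(Pi.single j 1) : Site d) = stepVec ((j, false) : Dir d) by simp [stepVec]]
      exact srwLaw_stepVec_eq hd n _ _
    rw [h1, h2]; ring
  simp only [hterm, Finset.sum_const, Finset.card_univ, Fintype.card_fin, nsmul_eq_mul]
  have hd0 : (d : ℝ) ≠ 0 := by exact_mod_cast (show d ≠ 0 by omega)
  field_simp

open Literature.Probability.LatticeModels Literature.Probability.LatticeModels.SRW in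
/-- `Σ_n p_n(e) = G_d − 1` at a neighbour `e` of the origin (`d ≥ 3`). [cite: HaraSladeSokal1993, Appendix A, eq. (A.17)-(A.18) (I_{1,0}(e₁) = s + 3s² + 12s³ + … = I_{1,0}(0) − 1); lane plumbing on the lace build's srwLaw] -/
theorem hasSum_srwLaw_stepVec {d : ℕ} (hd : 3 ≤ d) (s : Dir d) :
    HasSum (fun n => srwLaw d n (stepVec s)) (srwI d 1 0 0 - 1) := by
  have h := hasSum_srwLaw_srwI_one hd 0 (0 : Fin d → ℤ)
  simp only [zero_add] at h
  have h1 := (hasSum_nat_add_iff (f := fun n => srwLaw d n (0 : Fin d → ℤ)) 1 (g := srwI d 1 0 0 - 1)).2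
    (by simpa [Finset.sum_range_one, srwLaw_zero_apply] using h)
  have hfun : (fun n => srwLaw d (n + 1) (0 : Fin d → ℤ)) = fun n => srwLaw d n (stepVec s) := by
    funext n; exact srwLaw_succ_zero_eq_stepVec (by omega) n s
  rw [hfun] at h1
  exact h1

end Literature.Probability.FitznerVanDerHofstad2017


namespace Literature.Probability.RandomPlanarGeometry.SAW.Zd.LoopErasure

open Literature.Probability.LatticeModels Literature.Probability.LatticeModels.SRW
open Literature.Barriers.CriticalPhenomena Literature.Barriers.CriticalPhenomena.SAWLace
open Literature.Probability.FitznerVanDerHofstad2017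

variable {d : ℕ}

/-! ### Walks and self-avoiding walks avoiding a finite set -/

open Classical in
/-- The `n`-step walks (step sequences) whose positions at times `0, …, n` avoid `A`. [cite: HaraSladeSokal1993, Section 2.3, eq. (2.29)-(2.31) (lane plumbing for the count-level loop erasure)] -/
def avoidSet (A : Finset (Site d)) (n : ℕ) : Finset (StepSeq d n) :=
  Finset.univ.filter fun ω => ∀ t ≤ n, pos ω t ∉ A

open Classical in
/-- The `m`-step self-avoiding walks whose positions avoid `A`. [cite: HaraSladeSokal1993, Section 2.3, eq. (2.29)-(2.31) (lane plumbing for the count-level loop erasure)] -/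
def sawAvoid (A : Finset (Site d)) (m : ℕ) : Finset (StepSeq d m) :=
  Finset.univ.filter fun ζ => Set.InjOn (pos ζ) (Set.Icc 0 m) ∧ ∀ t ≤ m, pos ζ t ∉ A

/-- The shifted obstacle set `(A ∪ {0}) − e_s` seen from the site `e_s`. [cite: HaraSladeSokal1993, Section 2.3, eq. (2.29)-(2.31) (lane plumbing for the count-level loop erasure)] -/
def shiftSet (A : Finset (Site d)) (s : Dir d) : Finset (Site d) :=
  (insert (0 : Site d) A).image fun y => y - stepVec s

/-- Membership in the shifted obstacle `(A ∪ {0}) − e_s`. [cite: HaraSladeSokal1993, Section 2.3, eq. (2.29)-(2.31) (lane plumbing for the count-level loop erasure)] -/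
theorem mem_shiftSet {A : Finset (Site d)} {s : Dir d} {y : Site d} :
    y ∈ shiftSet A s ↔ y + stepVec s ∈ insert (0 : Site d) A := by
  unfold shiftSet
  rw [Finset.mem_image]
  constructor
  · rintro ⟨z, hz, rfl⟩
    rwa [sub_add_cancel]
  · intro h
    exact ⟨y + stepVec s, h, by rw [add_sub_cancel_right]⟩

/-- `−e_s ∈ (A ∪ {0}) − e_s`. [cite: HaraSladeSokal1993, Section 2.3, eq. (2.29)-(2.31) (lane plumbing for the count-level loop erasure)] -/
theorem neg_stepVec_mem_shiftSet (A : Finset (Site d)) (s : Dir d) : -stepVec s ∈ shiftSet A s := by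
  rw [mem_shiftSet, neg_add_cancel]
  exact Finset.mem_insert_self _ _

open Classical in
/-- Membership in `avoidSet`. [cite: HaraSladeSokal1993, Section 2.3, eq. (2.29)-(2.31) (lane plumbing for the count-level loop erasure)] -/
theorem mem_avoidSet {A : Finset (Site d)} {n : ℕ} {ω : StepSeq d n} :
    ω ∈ avoidSet A n ↔ ∀ t ≤ n, pos ω t ∉ A := by
  simp [avoidSet]

open Classical in
/-- Membership in `sawAvoid`. [cite: HaraSladeSokal1993, Section 2.3, eq. (2.29)-(2.31) (lane plumbing for the count-level loop erasure)] -/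
theorem mem_sawAvoid {A : Finset (Site d)} {m : ℕ} {ζ : StepSeq d m} :
    ζ ∈ sawAvoid A m ↔ Set.InjOn (pos ζ) (Set.Icc 0 m) ∧ ∀ t ≤ m, pos ζ t ∉ A := by
  simp [sawAvoid]

/-- If `0 ∈ A` no walk avoids `A` (it starts at `0`). [cite: HaraSladeSokal1993, Section 2.3, eq. (2.29)-(2.31) (lane plumbing for the count-level loop erasure)] -/
theorem avoidSet_eq_empty_of_mem {A : Finset (Site d)} (h : (0 : Site d) ∈ A) (n : ℕ) :
    avoidSet A n = ∅ := by
  ext ω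
  simp only [mem_avoidSet, Finset.notMem_empty, iff_false, not_forall, not_not]
  exact ⟨0, Nat.zero_le _, by rwa [pos_zero]⟩

/-- No self-avoiding walk avoids a set containing its starting point. [cite: HaraSladeSokal1993, Section 2.3, eq. (2.29)-(2.31) (lane plumbing for the count-level loop erasure)] -/
theorem sawAvoid_eq_empty_of_mem {A : Finset (Site d)} (h : (0 : Site d) ∈ A) (m : ℕ) :
    sawAvoid A m = ∅ := by
  ext ζ
  simp only [mem_sawAvoid, Finset.notMem_empty, iff_false, not_and, not_forall, not_not]
  exact fun _ => ⟨0, Nat.zero_le _, by rwa [pos_zero]⟩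

/-- `#sawAvoid A 0 = 1` when `0 ∉ A`. [cite: HaraSladeSokal1993, Section 2.3, eq. (2.29)-(2.31) (lane plumbing for the count-level loop erasure)] -/
theorem card_sawAvoid_zero {A : Finset (Site d)} (h : (0 : Site d) ∉ A) : (sawAvoid A 0).card = 1 := by
  classical
  have : sawAvoid A 0 = Finset.univ := by
    ext ζ
    simp only [mem_sawAvoid, Finset.mem_univ, iff_true]
    refine ⟨fun a ha b hb _ => ?_, fun t ht => ?_⟩
    · simp only [Set.mem_Icc, Nat.le_zero] at ha hb
      rw [ha.2, hb.2]
    · rw [Nat.le_zero.1 ht, pos_zero]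
      exact h
  rw [this, Finset.card_univ, card_stepSeq, pow_zero]

/-! ### Prepending a step: `Σ_s #sawAvoid ((A ∪ {0}) − e_s) m ≤ #sawAvoid A (m+1)` -/

/-- A walk starts at the origin (prepended form). [cite: HaraSladeSokal1993, Section 2.3, eq. (2.29)-(2.31) (lane plumbing for the count-level loop erasure)] -/
theorem pos_cons_zero' {m : ℕ} (s : Dir d) (ζ : StepSeq d m) : pos (Fin.cons s ζ : StepSeq d (m + 1)) 0 = 0 :=
  pos_zero _

/-- Prepending the step `s` to a self-avoiding walk avoiding `(A ∪ {0}) − e_s` gives a self-avoiding walk avoiding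
`A` (for `0 ∉ A`), injectively. [cite: HaraSladeSokal1993, §2.3] -/
theorem sum_card_sawAvoid_shift_le {A : Finset (Site d)} (h0 : (0 : Site d) ∉ A) (m : ℕ) :
    ∑ s : Dir d, (sawAvoid (shiftSet A s) m).card ≤ (sawAvoid A (m + 1)).card := by
  classical
  rw [← Finset.card_sigma]
  refine Finset.card_le_card_of_injOn (fun p => (Fin.cons p.1 p.2 : StepSeq d (m + 1))) ?_ ?_
  · rintro ⟨s, ζ⟩ hp
    rw [Finset.mem_coe, Finset.mem_sigma] at hp
    obtain ⟨-, hζ⟩ := hp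
    rw [mem_sawAvoid] at hζ
    obtain ⟨hinj, hav⟩ := hζ
    rw [Finset.mem_coe, mem_sawAvoid]
    -- positions: time 0 ↦ 0, time t+1 ↦ e_s + pos ζ t
    have hpos : ∀ t ≤ m, pos (Fin.cons s ζ : StepSeq d (m + 1)) (t + 1) = stepVec s + pos ζ t :=
      fun t _ => pos_cons_succ s ζ t
    have hne : ∀ t ≤ m, stepVec s + pos ζ t ≠ 0 := by
      intro t ht h
      have : pos ζ t = -stepVec s := by
        rw [← sub_eq_zero, sub_neg_eq_add, add_comm]; exact h
      exact hav t ht (this ▸ neg_stepVec_mem_shiftSet A s)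
    refine ⟨?_, ?_⟩
    · intro a ha b hb hab
      simp only [Set.mem_Icc] at ha hb
      rcases Nat.eq_zero_or_eq_succ_pred a with ha0 | ha1 <;>
        rcases Nat.eq_zero_or_eq_succ_pred b with hb0 | hb1
      · rw [ha0, hb0]
      · exfalso
        rw [ha0, hb1, pos_zero, hpos _ (by omega)] at hab
        exact hne _ (by omega) hab.symm
      · exfalso
        rw [hb0, ha1, pos_zero, hpos _ (by omega)] at hab
        exact hne _ (by omega) hab
      · rw [ha1, hb1, hpos _ (by omega), hpos _ (by omega), add_right_inj] at hab
        have := hinj (by simp only [Set.mem_Icc]; omega) (by simp only [Set.mem_Icc]; omega) hab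
        omega
    · intro t ht
      rcases Nat.eq_zero_or_eq_succ_pred t with ht0 | ht1
      · rw [ht0, pos_zero]; exact h0
      · rw [ht1, hpos _ (by omega)]
        intro hA
        refine hav (t.pred) (by omega) ?_
        rw [mem_shiftSet, add_comm]
        exact Finset.mem_insert_of_mem hA
  · rintro ⟨s, ζ⟩ - ⟨s', ζ'⟩ - h
    simp only at h
    obtain ⟨rfl, rfl⟩ := Fin.cons_injective2.eq_iff.1 h
    rfl

/-! ### Splitting a walk at its last visit to the origin -/

open Classical in
/-- The walks avoiding `A` whose last visit to `0` among the times `0, …, n` happens at time `σ`. [cite: HaraSladeSokal1993, Section 2.3, eq. (2.29)-(2.31) (lane plumbing for the count-level loop erasure)] -/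
def lastFiber (A : Finset (Site d)) (n σ : ℕ) : Finset (StepSeq d n) :=
  (avoidSet A n).filter fun ω => pos ω σ = 0 ∧ ∀ t, σ < t → t ≤ n → pos ω t ≠ 0

/-- Transport of the fibre cardinality along `n = n'`. [cite: HaraSladeSokal1993, Section 2.3, eq. (2.29)-(2.31) (lane plumbing for the count-level loop erasure)] -/
theorem card_lastFiber_congr {n n' : ℕ} (h : n = n') (A : Finset (Site d)) (σ : ℕ) :
    (lastFiber A n σ).card = (lastFiber A n' σ).card := by
  subst h; rfl

/-- Every walk has a last visit to the origin. [cite: HaraSladeSokal1993, Section 2.3, eq. (2.29)-(2.31) (lane plumbing for the count-level loop erasure)] -/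
theorem avoidSet_subset_biUnion (A : Finset (Site d)) (n : ℕ) :
    avoidSet A n ⊆ (range (n + 1)).biUnion (lastFiber A n) := by
  classical
  intro ω hω
  rw [Finset.mem_biUnion]
  set S := (range (n + 1)).filter (fun t => pos ω t = 0) with hS
  have hne : S.Nonempty := ⟨0, by simp [hS]⟩
  refine ⟨S.max' hne, (Finset.mem_filter.1 (S.max'_mem hne)).1, ?_⟩
  rw [lastFiber, Finset.mem_filter]
  refine ⟨hω, (Finset.mem_filter.1 (S.max'_mem hne)).2, fun t h1 h2 h3 => ?_⟩
  have ht : t ∈ S := Finset.mem_filter.2 ⟨Finset.mem_range.2 (by omega), h3⟩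
  exact absurd (S.le_max' t ht) (by omega)

/-- `#avoidSet A n ≤ Σ_σ #lastFiber A n σ`. [cite: HaraSladeSokal1993, Section 2.3, eq. (2.29)-(2.31) (lane plumbing for the count-level loop erasure)] -/
theorem card_avoidSet_le_sum (A : Finset (Site d)) (n : ℕ) :
    (avoidSet A n).card ≤ ∑ σ ∈ range (n + 1), (lastFiber A n σ).card :=
  (Finset.card_le_card (avoidSet_subset_biUnion A n)).trans Finset.card_biUnion_le

/-! ### Closed loops avoiding a set; the neighbour-avoiding loop numbers `w_σ` -/

open Classical in
/-- The closed `σ`-step walks at `0` all of whose positions avoid `A`. [cite: HaraSladeSokal1993, Section 2.3, eq. (2.29)-(2.31) (lane plumbing for the count-level loop erasure)] -/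
def closedAvoid (A : Finset (Site d)) (σ : ℕ) : Finset (StepSeq d σ) :=
  Finset.univ.filter fun ω => endpoint ω = 0 ∧ ∀ t, t ≤ σ → pos ω t ∉ A

/-- Membership in `closedAvoid`. [cite: HaraSladeSokal1993, Section 2.3, eq. (2.29)-(2.31) (lane plumbing for the count-level loop erasure)] -/
theorem mem_closedAvoid {A : Finset (Site d)} {σ : ℕ} {ω : StepSeq d σ} :
    ω ∈ closedAvoid A σ ↔ endpoint ω = 0 ∧ ∀ t, t ≤ σ → pos ω t ∉ A := by
  classical
  rw [closedAvoid, Finset.mem_filter]; simp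

/-- `#closedAvoid A σ ≤ u_σ`. [cite: HaraSladeSokal1993, Section 2.3, eq. (2.29)-(2.31) (lane plumbing for the count-level loop erasure)] -/
theorem card_closedAvoid_le_count (A : Finset (Site d)) (σ : ℕ) : (closedAvoid A σ).card ≤ SRW.count d σ 0 := by
  classical
  rw [SRW.count]
  refine Finset.card_le_card fun ω hω => ?_
  rw [mem_closedAvoid] at hω
  rw [Finset.mem_filter]
  exact ⟨Finset.mem_univ _, hω.1⟩

/-- Monotonicity in the obstacle. [cite: HaraSladeSokal1993, Section 2.3, eq. (2.29)-(2.31) (lane plumbing for the count-level loop erasure)] -/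
theorem card_closedAvoid_mono {A B : Finset (Site d)} (h : B ⊆ A) (σ : ℕ) :
    (closedAvoid A σ).card ≤ (closedAvoid B σ).card := by
  refine Finset.card_le_card fun ω hω => ?_
  rw [mem_closedAvoid] at hω ⊢
  exact ⟨hω.1, fun t ht hB => hω.2 t ht (h hB)⟩

/-- `w_σ := max_s #{closed σ-loops at 0 avoiding the neighbour e_s}` (all these numbers coincide by symmetry; the
maximum avoids proving it). [cite: HaraSladeSokal1993, §2.3, between (2.31) and (2.32)] -/
def nbLoops (d σ : ℕ) : ℕ :=
  (Finset.univ : Finset (Dir d)).sup fun s => (closedAvoid {stepVec s} σ).card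

/-- If `A` contains a neighbour of the origin then `#closedAvoid A σ ≤ w_σ`. [cite: HaraSladeSokal1993, Section 2.3, eq. (2.29)-(2.31) (lane plumbing for the count-level loop erasure)] -/
theorem card_closedAvoid_le_nbLoops {A : Finset (Site d)} {s : Dir d} (h : stepVec s ∈ A) (σ : ℕ) :
    (closedAvoid A σ).card ≤ nbLoops d σ := by
  refine (card_closedAvoid_mono (Finset.singleton_subset_iff.2 h) σ).trans ?_
  exact Finset.le_sup (f := fun s : Dir d => (closedAvoid {stepVec s} σ).card) (Finset.mem_univ s)

/-- `w_σ ≤ u_σ`. [cite: HaraSladeSokal1993, Section 2.3, eq. (2.29)-(2.31) (lane plumbing for the count-level loop erasure)] -/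
theorem nbLoops_le_count (σ : ℕ) : nbLoops d σ ≤ SRW.count d σ 0 := by
  rw [nbLoops]
  exact Finset.sup_le fun s _ => card_closedAvoid_le_count _ σ

/-- First-step exclusion: a closed `(σ+1)`-loop avoiding `e_s` does not start with the step `s`, and the closed
loops starting with `s` are counted by `count d σ (−e_s)`. [cite: HaraSladeSokal1993, Section 2.3, eq. (2.29)-(2.31) (lane plumbing for the count-level loop erasure)] -/
theorem card_closedAvoid_singleton_add_le (s : Dir d) (σ : ℕ) :
    (closedAvoid {stepVec s} (σ + 1)).card + SRW.count d σ (-stepVec s) ≤ SRW.count d (σ + 1) 0 := by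
  classical
  have hinj : Function.Injective (fun τ : StepSeq d σ => (Fin.cons s τ : StepSeq d (σ + 1))) :=
    fun τ τ' h => (Fin.cons_injective2 h).2
  rw [SRW.count, SRW.count,
    ← Finset.card_image_of_injective (Finset.univ.filter fun τ : StepSeq d σ => endpoint τ = -stepVec s) hinj]
  rw [← Finset.card_union_of_disjoint]
  · refine Finset.card_le_card fun ω hω => ?_
    rw [Finset.mem_union] at hω
    rw [Finset.mem_filter]
    refine ⟨Finset.mem_univ _, ?_⟩
    rcases hω with h | h
    · exact (mem_closedAvoid.1 h).1
    · rw [Finset.mem_image] at h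
      obtain ⟨τ, hτ, rfl⟩ := h
      rw [Finset.mem_filter] at hτ
      rw [endpoint_cons, hτ.2, add_neg_cancel]
  · rw [Finset.disjoint_left]
    intro ω h1 h2
    rw [Finset.mem_image] at h2
    obtain ⟨τ, _, rfl⟩ := h2
    have h := (mem_closedAvoid.1 h1).2 1 (by omega)
    have hpos : pos (Fin.cons s τ : StepSeq d (σ + 1)) (0 + 1) = stepVec s := by
      rw [pos_cons_succ, pos_zero, add_zero]
    exact h (by rw [Finset.mem_singleton]; exact hpos)

/-! ### Splitting a walk at its last visit to the origin: the two fibre bounds -/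

/-- The fibre `σ = n`: closed walks avoiding `A`. [cite: HaraSladeSokal1993, Section 2.3, eq. (2.29)-(2.31) (lane plumbing for the count-level loop erasure)] -/
theorem card_lastFiber_self_le (A : Finset (Site d)) (n : ℕ) : (lastFiber A n n).card ≤ (closedAvoid A n).card := by
  classical
  refine Finset.card_le_card fun ω hω => ?_
  rw [lastFiber, Finset.mem_filter, mem_avoidSet] at hω
  rw [mem_closedAvoid]
  exact ⟨by rw [← pos_eq_endpoint]; exact hω.2.1, hω.1⟩

/-- A one-step walk ends at its step. [cite: HaraSladeSokal1993, Section 2.3, eq. (2.29)-(2.31) (lane plumbing for the count-level loop erasure)] -/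
theorem pos_one_eq_stepVec (s1 : StepSeq d 1) : pos s1 1 = stepVec (s1 0) := by
  rw [pos_succ s1 (k := 0) (by omega), pos_zero, zero_add]
  rfl

/-- The fibre `σ < n = σ + (1 + r)`: a closed loop of length `σ` avoiding `A`, a step `s`, and a walk of length `r`
avoiding `(A ∪ {0}) − e_s` — injectively. [cite: HaraSladeSokal1993, §2.3] -/
theorem card_lastFiber_le (A : Finset (Site d)) (σ r : ℕ) :
    (lastFiber A (σ + (1 + r)) σ).card ≤
      (closedAvoid A σ).card * ∑ s : Dir d, (avoidSet (shiftSet A s) r).card := by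
  classical
  rw [← Finset.card_sigma, ← Finset.card_product]
  refine Finset.card_le_card_of_injOn
    (fun ω : StepSeq d (σ + (1 + r)) => (((Fin.appendEquiv σ (1 + r)).symm ω).1,
      (⟨((Fin.appendEquiv 1 r).symm ((Fin.appendEquiv σ (1 + r)).symm ω).2).1 0,
        ((Fin.appendEquiv 1 r).symm ((Fin.appendEquiv σ (1 + r)).symm ω).2).2⟩ : Σ _ : Dir d, StepSeq d r)))
    ?_ ?_
  · intro ω hω
    rw [Finset.mem_coe, lastFiber, Finset.mem_filter, mem_avoidSet] at hω
    obtain ⟨hav, hσ0, hlast⟩ := hω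
    set p := (Fin.appendEquiv σ (1 + r)).symm ω with hp
    set q := (Fin.appendEquiv 1 r).symm p.2 with hq
    have hω1 : Fin.append p.1 p.2 = ω := (Fin.appendEquiv σ (1 + r)).apply_symm_apply ω
    have hp2 : Fin.append q.1 q.2 = p.2 := (Fin.appendEquiv 1 r).apply_symm_apply p.2
    have hp1 : ∀ t, t ≤ σ → pos p.1 t = pos ω t := by
      intro t ht; rw [← pos_append_of_le p.1 p.2 ht, hω1]
    have hp1σ : pos p.1 σ = 0 := by rw [hp1 σ le_rfl, hσ0]
    -- positions of the tail: `pos q.2 k + e_s = pos ω (σ + (1 + k))`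
    have hposω : ∀ k, pos ω (σ + (1 + k)) = pos q.2 k + stepVec (q.1 0) := by
      intro k
      rw [← hω1, pos_append_add, ← hp2, pos_append_add, pos_one_eq_stepVec, hp1σ, zero_add, add_comm]
    rw [Finset.mem_coe, Finset.mem_product, mem_closedAvoid, Finset.mem_sigma, mem_avoidSet]
    refine ⟨⟨?_, fun t ht => ?_⟩, Finset.mem_univ _, fun k hk hmem => ?_⟩
    · rw [← pos_eq_endpoint, hp1σ]
    · rw [hp1 t ht]; exact hav t (by omega)
    · rw [mem_shiftSet, ← hposω k, Finset.mem_insert] at hmem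
      rcases hmem with h | h
      · exact hlast (σ + (1 + k)) (by omega) (by omega) h
      · exact hav (σ + (1 + k)) (by omega) h
  · intro ω _ ω' _ h
    simp only [Prod.mk.injEq, Sigma.mk.inj_iff, heq_eq_eq] at h
    obtain ⟨h1, h2, h3⟩ := h
    have hq : (Fin.appendEquiv 1 r).symm ((Fin.appendEquiv σ (1 + r)).symm ω).2 =
        (Fin.appendEquiv 1 r).symm ((Fin.appendEquiv σ (1 + r)).symm ω').2 := by
      refine Prod.ext ?_ h3
      funext i
      rw [Fin.fin_one_eq_zero i]
      exact h2
    have hp2 : ((Fin.appendEquiv σ (1 + r)).symm ω).2 = ((Fin.appendEquiv σ (1 + r)).symm ω').2 :=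
      (Fin.appendEquiv 1 r).symm.injective hq
    exact (Fin.appendEquiv σ (1 + r)).symm.injective (Prod.ext h1 hp2)

/-! ### Tuples of loops and the decoration inequality (parametric in the loop numbers) -/

/-- `T^v_r(k) = Σ_{k₁ + … + k_r = k} ∏ᵢ v(kᵢ)`: `r`-tuples of loops of total length `k`, the loops of length `j` being
counted by `v j`; convolution recursion. [cite: HaraSladeSokal1993, Section 2.3, eq. (2.29)-(2.31) (lane plumbing for the count-level loop erasure)] -/
def loopTuples (v : ℕ → ℕ) : ℕ → ℕ → ℕ
  | 0, k => if k = 0 then 1 else 0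
  | r + 1, k => ∑ σ ∈ range (k + 1), v σ * loopTuples v r (k - σ)

/-- `T^v_0(k) = [k = 0]`. [cite: HaraSladeSokal1993, Section 2.3, eq. (2.29)-(2.31) (lane plumbing for the count-level loop erasure)] -/
theorem loopTuples_zero (v : ℕ → ℕ) (k : ℕ) : loopTuples v 0 k = if k = 0 then 1 else 0 := rfl

/-- The convolution recursion for `T^v_{r+1}`. [cite: HaraSladeSokal1993, Section 2.3, eq. (2.29)-(2.31) (lane plumbing for the count-level loop erasure)] -/
theorem loopTuples_succ (v : ℕ → ℕ) (r k : ℕ) :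
    loopTuples v (r + 1) k = ∑ σ ∈ range (k + 1), v σ * loopTuples v r (k - σ) := rfl

/-- Tuples whose FIRST loop is counted by `v₁` and the others by `v`: `T^{v₁,v}_{r+1}(k) = Σ_σ v₁(σ) T^v_r(k − σ)`.
[cite: HaraSladeSokal1993, Section 2.3, eq. (2.29)-(2.31) (lane plumbing for the count-level loop erasure)] -/
def loopTuples₂ (v₁ v : ℕ → ℕ) : ℕ → ℕ → ℕ
  | 0, k => if k = 0 then 1 else 0
  | r + 1, k => ∑ σ ∈ range (k + 1), v₁ σ * loopTuples v r (k - σ)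

/-- The convolution formula for `T^{v₁,v}_{r+1}`. [cite: HaraSladeSokal1993, Section 2.3, eq. (2.29)-(2.31) (lane plumbing for the count-level loop erasure)] -/
theorem loopTuples₂_succ (v₁ v : ℕ → ℕ) (r k : ℕ) :
    loopTuples₂ v₁ v (r + 1) k = ∑ σ ∈ range (k + 1), v₁ σ * loopTuples v r (k - σ) := rfl

/-- `T^{v,v} = T^v`. [cite: HaraSladeSokal1993, Section 2.3, eq. (2.29)-(2.31) (lane plumbing for the count-level loop erasure)] -/
theorem loopTuples₂_self (v : ℕ → ℕ) : ∀ r k : ℕ, loopTuples₂ v v r k = loopTuples v r k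
  | 0, _ => rfl
  | _ + 1, _ => rfl

/-- `T^{v₁,v}_1(k) = v₁(k)`. [cite: HaraSladeSokal1993, Section 2.3, eq. (2.29)-(2.31) (lane plumbing for the count-level loop erasure)] -/
theorem loopTuples₂_one (v₁ v : ℕ → ℕ) (k : ℕ) : loopTuples₂ v₁ v 1 k = v₁ k := by
  rw [loopTuples₂_succ, Finset.sum_eq_single k]
  · rw [loopTuples_zero, if_pos (Nat.sub_self k), mul_one]
  · intro σ hσ hne
    rw [Finset.mem_range] at hσ
    rw [loopTuples_zero, if_neg (by omega), mul_zero]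
  · intro h; exact absurd (Finset.mem_range.2 (Nat.lt_succ_self k)) h

/-- Swapping a sum over the triangle `σ + m < n`. [cite: HaraSladeSokal1993, Section 2.3, eq. (2.29)-(2.31) (lane plumbing for the count-level loop erasure)] -/
theorem sum_triangle_comm {M : Type*} [AddCommMonoid M] (n : ℕ) (f : ℕ → ℕ → M) :
    ∑ σ ∈ range n, ∑ m ∈ range (n - σ), f σ m = ∑ m ∈ range n, ∑ σ ∈ range (n - m), f σ m :=
  Finset.sum_comm' fun σ m => by simp only [Finset.mem_range]; omega

/-- **The decoration step.** If the closed loops avoiding `A` are counted by `v₁` and, recursively, the walks of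
length `< n` avoiding the shifted obstacles `(A ∪ {0}) − e_s` obey the decoration inequality with loop numbers `v`,
then the `n`-step walks avoiding `A` obey it with `T^{v₁,v}`. [cite: HaraSladeSokal1993, §2.3, eq. (2.29)–(2.32)] -/
theorem avoid_card_step (v₁ v : ℕ → ℕ) (n : ℕ) (A : Finset (Site d)) (h0 : (0 : Site d) ∉ A)
    (hv₁ : ∀ σ, (closedAvoid A σ).card ≤ v₁ σ)
    (hrec : ∀ s : Dir d, (0 : Site d) ∉ shiftSet A s → ∀ r, r < n →
      (avoidSet (shiftSet A s) r).card ≤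
        ∑ m ∈ range (r + 1), (sawAvoid (shiftSet A s) m).card * loopTuples v (m + 1) (r - m)) :
    (avoidSet A n).card ≤ ∑ m ∈ range (n + 1), (sawAvoid A m).card * loopTuples₂ v₁ v (m + 1) (n - m) := by
  -- the fibres `σ < n`
  have hfib : ∀ σ ∈ range n, (lastFiber A n σ).card ≤ v₁ σ *
      ∑ m ∈ range (n - σ), loopTuples v (m + 1) (n - σ - 1 - m) * (sawAvoid A (m + 1)).card := by
    intro σ hσ
    rw [Finset.mem_range] at hσ
    rw [card_lastFiber_congr (show n = σ + (1 + (n - σ - 1)) by omega)]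
    refine (card_lastFiber_le A σ (n - σ - 1)).trans (Nat.mul_le_mul (hv₁ σ) ?_)
    calc ∑ s : Dir d, (avoidSet (shiftSet A s) (n - σ - 1)).card
        ≤ ∑ s : Dir d, ∑ m ∈ range (n - σ - 1 + 1),
            (sawAvoid (shiftSet A s) m).card * loopTuples v (m + 1) (n - σ - 1 - m) := by
          refine Finset.sum_le_sum fun s _ => ?_
          by_cases hs : (0 : Site d) ∈ shiftSet A s
          · rw [avoidSet_eq_empty_of_mem hs, Finset.card_empty]; exact Nat.zero_le _
          · exact hrec s hs (n - σ - 1) (by omega)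
      _ = ∑ m ∈ range (n - σ), loopTuples v (m + 1) (n - σ - 1 - m) *
            ∑ s : Dir d, (sawAvoid (shiftSet A s) m).card := by
          rw [Finset.sum_comm, show n - σ - 1 + 1 = n - σ by omega]
          refine Finset.sum_congr rfl fun m _ => ?_
          rw [Finset.mul_sum]
          refine Finset.sum_congr rfl fun s _ => ?_
          ring
      _ ≤ ∑ m ∈ range (n - σ), loopTuples v (m + 1) (n - σ - 1 - m) * (sawAvoid A (m + 1)).card := by
          refine Finset.sum_le_sum fun m _ => Nat.mul_le_mul_left _ ?_
          exact sum_card_sawAvoid_shift_le h0 m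
  calc (avoidSet A n).card ≤ ∑ σ ∈ range (n + 1), (lastFiber A n σ).card := card_avoidSet_le_sum A n
    _ = ∑ σ ∈ range n, (lastFiber A n σ).card + (lastFiber A n n).card := Finset.sum_range_succ _ _
    _ ≤ ∑ σ ∈ range n, v₁ σ *
          ∑ m ∈ range (n - σ), loopTuples v (m + 1) (n - σ - 1 - m) * (sawAvoid A (m + 1)).card +
          v₁ n := add_le_add (Finset.sum_le_sum hfib) ((card_lastFiber_self_le A n).trans (hv₁ n))
    _ = ∑ m ∈ range n, (sawAvoid A (m + 1)).card * loopTuples₂ v₁ v (m + 1 + 1) (n - (m + 1)) +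
          (sawAvoid A 0).card * loopTuples₂ v₁ v (0 + 1) (n - 0) := by
        rw [card_sawAvoid_zero h0, one_mul, Nat.sub_zero, zero_add, loopTuples₂_one]
        congr 1
        simp_rw [Finset.mul_sum]
        rw [sum_triangle_comm n]
        refine Finset.sum_congr rfl fun m hm => ?_
        rw [Finset.mem_range] at hm
        rw [loopTuples₂_succ, show n - (m + 1) + 1 = n - m by omega, Finset.mul_sum]
        refine Finset.sum_congr rfl fun σ _ => ?_
        rw [show n - (m + 1) - σ = n - σ - 1 - m by omega]
        ring
    _ = ∑ m ∈ range (n + 1), (sawAvoid A m).card * loopTuples₂ v₁ v (m + 1) (n - m) :=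
        (Finset.sum_range_succ' (fun m => (sawAvoid A m).card * loopTuples₂ v₁ v (m + 1) (n - m)) n).symm

/-- **The loop-erasure inequality, `k = 0`** (all loops counted by `u_σ = count d σ 0`): for `0 ∉ A`,
`#{n-step walks avoiding A} ≤ Σ_{m ≤ n} #{m-step SAWs avoiding A} · T^u_{m+1}(n − m)`.
[cite: HaraSladeSokal1993, §2.3, eq. (2.29)–(2.31)] -/
theorem avoid_card_le (n : ℕ) : ∀ A : Finset (Site d), (0 : Site d) ∉ A →
    (avoidSet A n).card ≤ ∑ m ∈ range (n + 1),
      (sawAvoid A m).card * loopTuples (fun σ => SRW.count d σ 0) (m + 1) (n - m) := by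
  induction n using Nat.strong_induction_on with
  | _ n ih =>
  intro A h0
  have h := avoid_card_step (fun σ => SRW.count d σ 0) (fun σ => SRW.count d σ 0) n A h0
    (fun σ => card_closedAvoid_le_count A σ) (fun s hs r hr => ih r hr _ hs)
  simpa only [loopTuples₂_self] using h

/-- **The loop-erasure inequality with neighbour-avoiding loops**: if `0 ∉ A` and `A` contains a neighbour of the
origin, then `#{n-step walks avoiding A} ≤ Σ_{m ≤ n} #{m-step SAWs avoiding A} · T^w_{m+1}(n − m)` — every loop met in
the recursion avoids the previous pivot, a neighbour of its base point. [cite: HaraSladeSokal1993, §2.3, (2.32) with k = 1] -/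
theorem avoid_card_le_nb (n : ℕ) : ∀ A : Finset (Site d), (0 : Site d) ∉ A → (∃ s : Dir d, stepVec s ∈ A) →
    (avoidSet A n).card ≤ ∑ m ∈ range (n + 1), (sawAvoid A m).card * loopTuples (nbLoops d) (m + 1) (n - m) := by
  induction n using Nat.strong_induction_on with
  | _ n ih =>
  intro A h0 hA
  obtain ⟨s₀, hs₀⟩ := hA
  have h := avoid_card_step (nbLoops d) (nbLoops d) n A h0 (fun σ => card_closedAvoid_le_nbLoops hs₀ σ)
    (fun s hs r hr => ih r hr _ hs ⟨s.neg, by rw [stepVec_neg]; exact neg_stepVec_mem_shiftSet A s⟩)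
  simpa only [loopTuples₂_self] using h

/-! ### No obstacle: `(2d)ⁿ ≤ Σ_{m ≤ n} c_m · T^{u,w}_{m+1}(n − m)` -/

/-- `#avoidSet ∅ n = (2d)ⁿ`. [cite: HaraSladeSokal1993, Section 2.3, eq. (2.29)-(2.31) (lane plumbing for the count-level loop erasure)] -/
theorem card_avoidSet_empty (n : ℕ) : (avoidSet (∅ : Finset (Site d)) n).card = (2 * d) ^ n := by
  classical
  have : avoidSet (∅ : Finset (Site d)) n = Finset.univ := by
    ext ω; simp [mem_avoidSet]
  rw [this, Finset.card_univ, card_stepSeq]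

/-- `#sawAvoid ∅ m = c_m`. [cite: HaraSladeSokal1993, Section 2.3, eq. (2.29)-(2.31) (lane plumbing for the count-level loop erasure)] -/
theorem card_sawAvoid_empty (m : ℕ) : (sawAvoid (∅ : Finset (Site d)) m).card = count d m := by
  classical
  rw [count, Finset.card_eq_sum_card_fiberwise (f := fun ζ : StepSeq d m => pos ζ m) (t := box d m)
    (fun ζ _ => by exact pos_mem_box ζ m)]
  refine Finset.sum_congr rfl fun x _ => ?_
  rw [← card_sawSet]
  congr 1
  ext ζ
  simp only [Finset.mem_filter, mem_sawAvoid, Finset.notMem_empty, not_false_eq_true, implies_true, and_true,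
    mem_sawSet]

/-- A unit step is non-zero. [cite: HaraSladeSokal1993, Section 2.3, eq. (2.29)-(2.31) (lane plumbing for the count-level loop erasure)] -/
theorem stepVec_ne_zero (s : Dir d) : stepVec s ≠ (0 : Site d) := by
  intro h
  have := congrFun h s.1
  rw [stepVec_apply, if_pos rfl] at this
  by_cases hb : s.2 = true
  · rw [if_pos hb] at this; simp at this
  · rw [if_neg hb] at this; simp at this

/-- `0 ∉ {−e_s}`. [cite: HaraSladeSokal1993, Section 2.3, eq. (2.29)-(2.31) (lane plumbing for the count-level loop erasure)] -/
theorem zero_notMem_shiftSet_empty (s : Dir d) : (0 : Site d) ∉ shiftSet (∅ : Finset (Site d)) s := by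
  rw [mem_shiftSet, zero_add, Finset.mem_insert]
  rintro (h | h)
  · exact stepVec_ne_zero s h
  · simp at h

/-- **`(2d)ⁿ ≤ Σ_{m ≤ n} c_m T^{u,w}_{m+1}(n − m)`**: every `n`-step walk is a self-avoiding walk decorated with closed
loops, the loop at the `j`-th pivot (`j ≥ 1`) avoiding the `(j−1)`-st pivot. [cite: HaraSladeSokal1993, §2.3, (2.29), (2.32), k = 1] -/
theorem pow_le_sum_count_mul_loopTuples₂ (n : ℕ) :
    (2 * d) ^ n ≤ ∑ m ∈ range (n + 1),
      count d m * loopTuples₂ (fun σ => SRW.count d σ 0) (nbLoops d) (m + 1) (n - m) := by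
  have h := avoid_card_step (fun σ => SRW.count d σ 0) (nbLoops d) n (∅ : Finset (Site d)) (Finset.notMem_empty _)
    (fun σ => card_closedAvoid_le_count _ σ)
    (fun s hs r _ => avoid_card_le_nb r _ hs ⟨s.neg, by rw [stepVec_neg]; exact neg_stepVec_mem_shiftSet _ s⟩)
  rw [card_avoidSet_empty] at h
  simpa only [card_sawAvoid_empty] using h

/-- The `k = 0` form `(2d)ⁿ ≤ Σ_{m ≤ n} c_m T^u_{m+1}(n − m)`. [cite: HaraSladeSokal1993, §2.3, eq. (2.31)] -/
theorem pow_le_sum_count_mul_loopTuples (n : ℕ) :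
    (2 * d) ^ n ≤ ∑ m ∈ range (n + 1), count d m * loopTuples (fun σ => SRW.count d σ 0) (m + 1) (n - m) := by
  have h := avoid_card_le (d := d) n ∅ (Finset.notMem_empty _)
  rw [card_avoidSet_empty] at h
  simpa only [card_sawAvoid_empty] using h

/-! ### Generating-function bookkeeping with finite sums -/

/-- Swapping the convolution double sum `Σ_{n ≤ N} Σ_{m ≤ n} f(m) g(m, n − m) = Σ_{m ≤ N} f(m) Σ_{k ≤ N − m} g(m, k)`.
[cite: HaraSladeSokal1993, Section 2.3, eq. (2.29)-(2.31) (lane plumbing for the count-level loop erasure)] -/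
theorem sum_sum_range_convolution (N : ℕ) (f : ℕ → ℝ) (g : ℕ → ℕ → ℝ) :
    ∑ n ∈ range (N + 1), ∑ m ∈ range (n + 1), f m * g m (n - m) =
      ∑ m ∈ range (N + 1), f m * ∑ k ∈ range (N + 1 - m), g m k := by
  rw [Finset.sum_comm' (t' := range (N + 1)) (s' := fun m => Ico m (N + 1))
    (fun n m => by simp only [Finset.mem_range, Finset.mem_Ico]; omega)]
  refine Finset.sum_congr rfl fun m _ => ?_
  rw [Finset.mul_sum, Finset.sum_Ico_eq_sum_range]
  refine Finset.sum_congr rfl fun k _ => ?_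
  rw [Nat.add_sub_cancel_left]

/-- One convolution: `Σ_{k ≤ K} (Σ_{σ ≤ k} v₁(σ) g(k − σ)) βᵏ ≤ (Σ_{σ ≤ K} v₁(σ) β^σ)(Σ_{j ≤ K} g(j) βʲ)` (`β ≥ 0`).
[cite: HaraSladeSokal1993, Section 2.3, eq. (2.29)-(2.31) (lane plumbing for the count-level loop erasure)] -/
theorem sum_convolution_mul_pow_le {β : ℝ} (hβ : 0 ≤ β) (v₁ g : ℕ → ℕ) (K : ℕ) :
    ∑ k ∈ range (K + 1), ((∑ σ ∈ range (k + 1), v₁ σ * g (k - σ) : ℕ) : ℝ) * β ^ k ≤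
      (∑ σ ∈ range (K + 1), (v₁ σ : ℝ) * β ^ σ) * ∑ j ∈ range (K + 1), (g j : ℝ) * β ^ j := by
  calc ∑ k ∈ range (K + 1), ((∑ σ ∈ range (k + 1), v₁ σ * g (k - σ) : ℕ) : ℝ) * β ^ k
      = ∑ k ∈ range (K + 1), ∑ σ ∈ range (k + 1),
          ((v₁ σ : ℝ) * β ^ σ) * ((g (k - σ) : ℝ) * β ^ (k - σ)) := by
        refine Finset.sum_congr rfl fun k _ => ?_
        push_cast
        rw [Finset.sum_mul]
        refine Finset.sum_congr rfl fun σ hσ => ?_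
        rw [Finset.mem_range] at hσ
        rw [show β ^ k = β ^ σ * β ^ (k - σ) by rw [← pow_add]; congr 1; omega]
        ring
    _ = ∑ σ ∈ range (K + 1), ((v₁ σ : ℝ) * β ^ σ) * ∑ j ∈ range (K + 1 - σ), (g j : ℝ) * β ^ j :=
        sum_sum_range_convolution K _ fun _ j => (g j : ℝ) * β ^ j
    _ ≤ ∑ σ ∈ range (K + 1), ((v₁ σ : ℝ) * β ^ σ) * ∑ j ∈ range (K + 1), (g j : ℝ) * β ^ j := by
        refine Finset.sum_le_sum fun σ _ => mul_le_mul_of_nonneg_left ?_ (by positivity)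
        have hsub : range (K + 1 - σ) ⊆ range (K + 1) := Finset.range_mono (Nat.sub_le _ _)
        exact Finset.sum_le_sum_of_subset_of_nonneg hsub fun j _ _ => by positivity
    _ = _ := by rw [← Finset.sum_mul]

/-- `Σ_{k ≤ K} T^v_r(k) βᵏ ≤ (Σ_{j ≤ K} v(j) βʲ)^r` for `β ≥ 0`. [cite: HaraSladeSokal1993, Section 2.3, eq. (2.29)-(2.31) (lane plumbing for the count-level loop erasure)] -/
theorem sum_loopTuples_mul_pow_le {β : ℝ} (hβ : 0 ≤ β) (v : ℕ → ℕ) (K : ℕ) : ∀ r : ℕ,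
    ∑ k ∈ range (K + 1), (loopTuples v r k : ℝ) * β ^ k ≤ (∑ j ∈ range (K + 1), (v j : ℝ) * β ^ j) ^ r
  | 0 => by
    rw [pow_zero, Finset.sum_eq_single 0]
    · simp [loopTuples_zero]
    · intro k _ hk
      rw [loopTuples_zero, if_neg hk]; simp
    · intro h; exact absurd (Finset.mem_range.2 (Nat.succ_pos K)) h
  | r + 1 => by
    have ih := sum_loopTuples_mul_pow_le hβ v K r
    have hS0 : 0 ≤ ∑ j ∈ range (K + 1), (v j : ℝ) * β ^ j := Finset.sum_nonneg fun j _ => by positivity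
    calc ∑ k ∈ range (K + 1), (loopTuples v (r + 1) k : ℝ) * β ^ k
        ≤ (∑ σ ∈ range (K + 1), (v σ : ℝ) * β ^ σ) * ∑ j ∈ range (K + 1), (loopTuples v r j : ℝ) * β ^ j :=
          sum_convolution_mul_pow_le hβ v (loopTuples v r) K
      _ ≤ (∑ σ ∈ range (K + 1), (v σ : ℝ) * β ^ σ) * (∑ j ∈ range (K + 1), (v j : ℝ) * β ^ j) ^ r :=
          mul_le_mul_of_nonneg_left ih hS0
      _ = _ := by ring

/-- `Σ_{k ≤ K} T^{v₁,v}_{r+1}(k) βᵏ ≤ (Σ_{j ≤ K} v₁(j) βʲ)(Σ_{j ≤ K} v(j) βʲ)^r` for `β ≥ 0`. [cite: HaraSladeSokal1993, Section 2.3, eq. (2.29)-(2.31) (lane plumbing for the count-level loop erasure)] -/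
theorem sum_loopTuples₂_mul_pow_le {β : ℝ} (hβ : 0 ≤ β) (v₁ v : ℕ → ℕ) (K r : ℕ) :
    ∑ k ∈ range (K + 1), (loopTuples₂ v₁ v (r + 1) k : ℝ) * β ^ k ≤
      (∑ j ∈ range (K + 1), (v₁ j : ℝ) * β ^ j) * (∑ j ∈ range (K + 1), (v j : ℝ) * β ^ j) ^ r := by
  have hS0 : 0 ≤ ∑ j ∈ range (K + 1), (v₁ j : ℝ) * β ^ j := Finset.sum_nonneg fun j _ => by positivity
  exact (sum_convolution_mul_pow_le hβ v₁ (loopTuples v r) K).trans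
    (mul_le_mul_of_nonneg_left (sum_loopTuples_mul_pow_le hβ v K r) hS0)

/-- `count d n x (2d)^{−n} = p_n(x)`. [cite: HaraSladeSokal1993, Section 2.3, eq. (2.29)-(2.31) (lane plumbing for the count-level loop erasure)] -/
theorem count_mul_pow_eq_srwLaw (n : ℕ) (x : Site d) :
    (SRW.count d n x : ℝ) * (1 / (2 * (d : ℝ))) ^ n = LongRangePhi4.srwLaw d n x := by
  rw [← prob_eq_srwLaw, SRW.prob, one_div_pow, mul_one_div]

/-- The partial sums of the return probabilities are bounded by the Green function:
`Σ_{j ≤ K} u_j (2d)^{−j} = Σ_{j ≤ K} p_j(0) ≤ G_d = srwI d 1 0 0` (`d ≥ 3`).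
[cite: HaraSladeSokal1993, §2.3, eq. (2.31)] -/
theorem sum_count_mul_pow_le_srwI (hd : 3 ≤ d) (K : ℕ) :
    ∑ j ∈ range (K + 1), (SRW.count d j 0 : ℝ) * (1 / (2 * (d : ℝ))) ^ j ≤ srwI d 1 0 0 := by
  have h := hasSum_srwLaw_srwI_one hd 0 (0 : Fin d → ℤ)
  simp only [zero_add] at h
  simp_rw [count_mul_pow_eq_srwLaw]
  exact sum_le_hasSum _ (fun j _ => LongRangePhi4.srwLaw_nonneg _ _) h

/-- `1 ≤ G_d` (`p₀(0) = 1`). [cite: HaraSladeSokal1993, Section 2.3, eq. (2.29)-(2.31) (lane plumbing for the count-level loop erasure)] -/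
theorem one_le_srwI_one (hd : 3 ≤ d) : 1 ≤ srwI d 1 0 0 := by
  have h := sum_count_mul_pow_le_srwI hd 0
  rw [Finset.sum_range_one, pow_zero, mul_one, SRW.count_zero, if_pos rfl, Nat.cast_one] at h
  exact h

/-! ### The neighbour-avoiding loop generating function: `Σ_σ w_σ (2d)^{−σ} ≤ G_d − (G_d − 1)/(2d)` -/

/-- `w_{σ+1} (2d)^{−(σ+1)} ≤ p_{σ+1}(0) − p_σ(e)/(2d)` for any unit vector `e` (first-step exclusion + symmetry).
[cite: HaraSladeSokal1993, §2.3, (2.33) (the exact value is `C₀^{\{e\}} = 2 − 1/C₀`; this is its first-step bound)] -/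
theorem nbLoops_succ_mul_pow_le (hd : 1 ≤ d) (σ : ℕ) (e : Dir d) :
    (nbLoops d (σ + 1) : ℝ) * (1 / (2 * (d : ℝ))) ^ (σ + 1) ≤
      LongRangePhi4.srwLaw d (σ + 1) 0 - 1 / (2 * (d : ℝ)) * LongRangePhi4.srwLaw d σ (stepVec e) := by
  have hne : (Finset.univ : Finset (Dir d)).Nonempty := ⟨(⟨0, by omega⟩, true), Finset.mem_univ _⟩
  obtain ⟨s, _, hs⟩ := Finset.exists_mem_eq_sup _ hne fun s : Dir d => (closedAvoid {stepVec s} (σ + 1)).card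
  rw [nbLoops, hs]
  have h := card_closedAvoid_singleton_add_le (d := d) s σ
  have h' : ((closedAvoid {stepVec s} (σ + 1)).card : ℝ) ≤ (SRW.count d (σ + 1) 0 : ℝ) - SRW.count d σ (-stepVec s) := by
    have := (Nat.cast_le (α := ℝ)).2 h
    push_cast at this
    linarith
  have hβ : (0 : ℝ) ≤ (1 / (2 * (d : ℝ))) ^ (σ + 1) := by positivity
  calc ((closedAvoid {stepVec s} (σ + 1)).card : ℝ) * (1 / (2 * (d : ℝ))) ^ (σ + 1)
      ≤ ((SRW.count d (σ + 1) 0 : ℝ) - SRW.count d σ (-stepVec s)) * (1 / (2 * (d : ℝ))) ^ (σ + 1) :=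
        mul_le_mul_of_nonneg_right h' hβ
    _ = LongRangePhi4.srwLaw d (σ + 1) 0 - 1 / (2 * (d : ℝ)) * LongRangePhi4.srwLaw d σ (stepVec e) := by
        rw [sub_mul, count_mul_pow_eq_srwLaw, pow_succ, ← mul_assoc, count_mul_pow_eq_srwLaw, ← stepVec_neg,
          srwLaw_stepVec_eq hd σ s.neg e]
        ring

/-- **`Σ_{σ ≤ K} w_σ (2d)^{−σ} ≤ G_d − (G_d − 1)/(2d)`** for every `K` (`d ≥ 3`), using `Σ_σ p_σ(e) = G_d − 1`.
[cite: HaraSladeSokal1993, §2.3, (2.32)–(2.33)] -/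
theorem sum_nbLoops_mul_pow_le (hd : 3 ≤ d) (K : ℕ) :
    ∑ j ∈ range (K + 1), (nbLoops d j : ℝ) * (1 / (2 * (d : ℝ))) ^ j ≤
      srwI d 1 0 0 - 1 / (2 * (d : ℝ)) * (srwI d 1 0 0 - 1) := by
  have hd1 : 1 ≤ d := by omega
  set e : Dir d := (⟨0, by omega⟩, true) with he
  set β : ℝ := 1 / (2 * (d : ℝ)) with hβ
  -- the shifted neighbour law `q' σ = p_{σ−1}(e)` (`q' 0 = 0`) and its sum `G − 1`
  set q' : ℕ → ℝ := fun σ => if σ = 0 then 0 else LongRangePhi4.srwLaw d (σ - 1) (stepVec e) with hq'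
  have hq : HasSum q' (srwI d 1 0 0 - 1) := by
    have h1 : HasSum (fun n => q' (n + 1)) (srwI d 1 0 0 - 1) := by
      have : (fun n => q' (n + 1)) = fun n => LongRangePhi4.srwLaw d n (stepVec e) := by
        funext n; simp [hq']
      rw [this]; exact hasSum_srwLaw_stepVec hd e
    have h2 := (hasSum_nat_add_iff (f := q') 1).1 h1
    simpa [Finset.sum_range_one, hq'] using h2
  have h0 := hasSum_srwLaw_srwI_one hd 0 (0 : Fin d → ℤ)
  simp only [zero_add] at h0
  have hb : HasSum (fun σ => LongRangePhi4.srwLaw d σ 0 - β * q' σ) (srwI d 1 0 0 - β * (srwI d 1 0 0 - 1)) :=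
    h0.sub (hq.mul_left β)
  -- termwise domination
  have hterm : ∀ σ, (nbLoops d σ : ℝ) * β ^ σ ≤ LongRangePhi4.srwLaw d σ 0 - β * q' σ := by
    intro σ
    cases σ with
    | zero =>
      simp only [hq', if_true, mul_zero, sub_zero, pow_zero, mul_one, LongRangePhi4.srwLaw_zero_apply, if_pos rfl]
      have := nbLoops_le_count (d := d) 0
      rw [SRW.count_zero, if_pos rfl] at this
      exact_mod_cast this
    | succ σ =>
      have h := nbLoops_succ_mul_pow_le hd1 σ e
      simp only [hq', Nat.succ_ne_zero, if_false, Nat.succ_sub_one]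
      exact h
  have hnonneg : ∀ σ, 0 ≤ LongRangePhi4.srwLaw d σ 0 - β * q' σ :=
    fun σ => le_trans (by positivity) (hterm σ)
  calc ∑ j ∈ range (K + 1), (nbLoops d j : ℝ) * β ^ j
      ≤ ∑ j ∈ range (K + 1), (LongRangePhi4.srwLaw d j 0 - β * q' j) := Finset.sum_le_sum fun j _ => hterm j
    _ ≤ srwI d 1 0 0 - β * (srwI d 1 0 0 - 1) := sum_le_hasSum _ (fun j _ => hnonneg j) hb

/-! ### From the decoration inequality to a lower bound on `μ` -/

/-- **`N + 1 ≤ Σ_{m ≤ N} c_m β^m F(m)`** whenever `(2d)ⁿ ≤ Σ_{m ≤ n} c_m L(m+1, n−m)` for all `n` and the generating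
functions of `L(m+1, ·)` are bounded by `F(m)` (`β = 1/2d`). [cite: HaraSladeSokal1993, §2.3, eq. (2.29)] -/
theorem succ_le_sum_count_mul_pow_of (hd : 1 ≤ d) (L : ℕ → ℕ → ℕ) (F : ℕ → ℝ)
    (hL : ∀ n, (2 * d) ^ n ≤ ∑ m ∈ range (n + 1), count d m * L (m + 1) (n - m))
    (hF : ∀ K m, ∑ k ∈ range (K + 1), (L (m + 1) k : ℝ) * (1 / (2 * (d : ℝ))) ^ k ≤ F m) (N : ℕ) :
    (N : ℝ) + 1 ≤ ∑ m ∈ range (N + 1), (count d m : ℝ) * (1 / (2 * (d : ℝ))) ^ m * F m := by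
  set β : ℝ := 1 / (2 * (d : ℝ)) with hβdef
  have hd0 : (0 : ℝ) < 2 * (d : ℝ) := by
    have : (1 : ℝ) ≤ d := by exact_mod_cast hd
    linarith
  have hβ : 0 ≤ β := by positivity
  -- `N + 1 = Σ_{n ≤ N} (2d)ⁿ βⁿ`
  have hN : (N : ℝ) + 1 = ∑ n ∈ range (N + 1), ((2 * d) ^ n : ℕ) * β ^ n := by
    have : ∀ n : ℕ, (((2 * d) ^ n : ℕ) : ℝ) * β ^ n = 1 := by
      intro n
      push_cast
      rw [← mul_pow, hβdef, mul_one_div_cancel hd0.ne', one_pow]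
    simp only [this, Finset.sum_const, Finset.card_range, nsmul_eq_mul, mul_one]
    push_cast; ring
  rw [hN]
  calc ∑ n ∈ range (N + 1), (((2 * d) ^ n : ℕ) : ℝ) * β ^ n
      ≤ ∑ n ∈ range (N + 1), ∑ m ∈ range (n + 1),
          ((count d m : ℝ) * β ^ m) * ((L (m + 1) (n - m) : ℝ) * β ^ (n - m)) := by
        refine Finset.sum_le_sum fun n _ => ?_
        have h' : (((2 * d) ^ n : ℕ) : ℝ) ≤ ∑ m ∈ range (n + 1), (count d m : ℝ) * (L (m + 1) (n - m) : ℝ) := by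
          exact_mod_cast hL n
        calc (((2 * d) ^ n : ℕ) : ℝ) * β ^ n
            ≤ (∑ m ∈ range (n + 1), (count d m : ℝ) * (L (m + 1) (n - m) : ℝ)) * β ^ n :=
              mul_le_mul_of_nonneg_right h' (by positivity)
          _ = _ := by
              rw [Finset.sum_mul]
              refine Finset.sum_congr rfl fun m hm => ?_
              rw [Finset.mem_range] at hm
              rw [show β ^ n = β ^ m * β ^ (n - m) by rw [← pow_add]; congr 1; omega]
              ring
    _ = ∑ m ∈ range (N + 1), ((count d m : ℝ) * β ^ m) *
          ∑ k ∈ range (N + 1 - m), (L (m + 1) k : ℝ) * β ^ k :=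
        sum_sum_range_convolution N _ fun m k => (L (m + 1) k : ℝ) * β ^ k
    _ ≤ ∑ m ∈ range (N + 1), ((count d m : ℝ) * β ^ m) * F m := by
        refine Finset.sum_le_sum fun m hm => mul_le_mul_of_nonneg_left ?_ (by positivity)
        rw [Finset.mem_range] at hm
        rw [show N + 1 - m = N - m + 1 by omega]
        exact hF (N - m) m

/-- **The limit argument.** If `N + 1 ≤ Σ_{m ≤ N} c_m (2d)^{−m} · C W^m` for every `N` (`C ≥ 0`, `W > 0`), then
`2d / W ≤ μ(ℤ^d)`: otherwise `c_m ≤ θ^m` eventually with `ρ = θ W / 2d < 1` and the right side stays bounded.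
[cite: HaraSladeSokal1993, §2.3, eq. (2.29)] -/
theorem two_mul_div_le_connectiveConstant_of (hd : 1 ≤ d) {C W : ℝ} (hC : 0 ≤ C) (hW : 0 < W)
    (h : ∀ N : ℕ, (N : ℝ) + 1 ≤ ∑ m ∈ range (N + 1), (count d m : ℝ) * (1 / (2 * (d : ℝ))) ^ m * (C * W ^ m)) :
    2 * (d : ℝ) / W ≤ connectiveConstant d := by
  haveI : NeZero d := ⟨by omega⟩
  have hd0 : (0 : ℝ) < 2 * (d : ℝ) := by
    have : (1 : ℝ) ≤ d := by exact_mod_cast hd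
    linarith
  by_contra hlt
  rw [not_le] at hlt
  have hμ0 : 0 < connectiveConstant d := connectiveConstant_pos d
  obtain ⟨θ, hμθ, hθ⟩ := exists_between hlt
  have hθ0 : 0 < θ := hμ0.trans hμθ
  set β : ℝ := 1 / (2 * (d : ℝ)) with hβdef
  have hβ0 : 0 ≤ β := by positivity
  set ρ := θ * (β * W) with hρdef
  have hρ0 : 0 ≤ ρ := by positivity
  have hρ1 : ρ < 1 := by
    have h1 : θ * W < 2 * d := by
      calc θ * W < 2 * d / W * W := mul_lt_mul_of_pos_right hθ hW
        _ = 2 * d := div_mul_cancel₀ _ hW.ne'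
    have h2 : ρ = θ * W / (2 * d) := by rw [hρdef, hβdef]; ring
    rw [h2, div_lt_one hd0]
    exact h1
  -- eventually `c_m ≤ θ^m`
  have hev : ∀ᶠ m : ℕ in atTop, (count d m : ℝ) ≤ θ ^ m := by
    have h1 := (tendsto_count_rpow d).eventually_mem (Iio_mem_nhds hμθ)
    filter_upwards [h1, eventually_ge_atTop 1] with m hm hm1
    rw [Set.mem_Iio] at hm
    have hc0 : 0 ≤ (count d m : ℝ) := Nat.cast_nonneg _
    have hm0 : (m : ℝ) ≠ 0 := by exact_mod_cast (by omega : m ≠ 0)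
    calc (count d m : ℝ) = ((count d m : ℝ) ^ (1 / (m : ℝ))) ^ (m : ℝ) := by
          rw [← Real.rpow_mul hc0, one_div_mul_cancel hm0, Real.rpow_one]
      _ = ((count d m : ℝ) ^ (1 / (m : ℝ))) ^ m := Real.rpow_natCast _ _
      _ ≤ θ ^ m := pow_le_pow_left₀ (Real.rpow_nonneg hc0 _) hm.le m
  obtain ⟨m₀, hm₀⟩ := Filter.eventually_atTop.1 hev
  -- the terms `a_m = c_m β^m C W^m` and their tail bound `a_m ≤ C ρ^m` (`m ≥ m₀`)
  set a : ℕ → ℝ := fun m => (count d m : ℝ) * β ^ m * (C * W ^ m) with hadef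
  have ha0 : ∀ m, 0 ≤ a m := fun m => by positivity
  have ha_tail : ∀ m, m₀ ≤ m → a m ≤ C * ρ ^ m := by
    intro m hm
    have e1 : a m = (count d m : ℝ) * (β * W) ^ m * C := by
      simp only [hadef]; rw [mul_pow]; ring
    have e2 : C * ρ ^ m = θ ^ m * (β * W) ^ m * C := by
      rw [hρdef, mul_pow]; ring
    rw [e1, e2]
    have hBW : 0 ≤ (β * W) ^ m * C := by positivity
    nlinarith [mul_le_mul_of_nonneg_right (hm₀ m hm) hBW]
  set C₀ := ∑ m ∈ range m₀, a m with hC₀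
  have hbound : ∀ N : ℕ, (N : ℝ) + 1 ≤ C₀ + C / (1 - ρ) := by
    intro N
    have h1 : (N : ℝ) + 1 ≤ ∑ m ∈ range (N + 1), a m := h N
    have hpt : ∀ m, a m ≤ (if m < m₀ then a m else 0) + C * ρ ^ m := by
      intro m
      split_ifs with h
      · linarith [mul_nonneg hC (pow_nonneg hρ0 m)]
      · rw [zero_add]; exact ha_tail m (by omega)
    have hsplit : ∑ m ∈ range (N + 1), a m ≤ C₀ + C * ∑ m ∈ range (N + 1), ρ ^ m := by
      calc ∑ m ∈ range (N + 1), a m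
          ≤ ∑ m ∈ range (N + 1), ((if m < m₀ then a m else 0) + C * ρ ^ m) :=
            Finset.sum_le_sum fun m _ => hpt m
        _ = (∑ m ∈ range (N + 1), if m < m₀ then a m else 0) + C * ∑ m ∈ range (N + 1), ρ ^ m := by
            rw [Finset.sum_add_distrib, Finset.mul_sum]
        _ ≤ C₀ + C * ∑ m ∈ range (N + 1), ρ ^ m := by
            refine add_le_add ?_ le_rfl
            rw [Finset.sum_ite, Finset.sum_const_zero, add_zero, hC₀]
            refine Finset.sum_le_sum_of_subset_of_nonneg ?_ (fun m _ _ => ha0 m)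
            intro m hm
            simp only [Finset.mem_filter, Finset.mem_range] at hm ⊢
            exact hm.2
    have hgeom : ∑ m ∈ range (N + 1), ρ ^ m ≤ 1 / (1 - ρ) := by
      rw [le_div_iff₀ (by linarith), geom_sum_mul_neg]
      linarith [pow_nonneg hρ0 (N + 1)]
    calc (N : ℝ) + 1 ≤ ∑ m ∈ range (N + 1), a m := h1
      _ ≤ C₀ + C * ∑ m ∈ range (N + 1), ρ ^ m := hsplit
      _ ≤ C₀ + C * (1 / (1 - ρ)) := by gcongr
      _ = C₀ + C / (1 - ρ) := by rw [mul_one_div]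
  obtain ⟨N, hN⟩ := exists_nat_gt (C₀ + C / (1 - ρ))
  have := hbound N
  linarith

/-! ### The two loop-erasure bounds on the connective constant -/

/-- **Hara–Slade–Sokal `k = 0`: `μ(ℤ^d) ≥ 2d / C₀(0,0;1/2d) = 2d / G_d`** for every `d ≥ 3`
(`G_d = srwI d 1 0 0 = Σ_m p_m(0)`). AS PRINTED: "(2.29) becomes `μ ≥ 2d / C₀(0,0;1/2d)` [`k = 0`] (2.31)".
[cite: HaraSladeSokal1993, §2.3, eq. (2.31)] -/
theorem two_mul_div_srwI_le_connectiveConstant (hd : 3 ≤ d) :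
    2 * (d : ℝ) / srwI d 1 0 0 ≤ connectiveConstant d := by
  set G := srwI d 1 0 0 with hGdef
  have hG1 : 1 ≤ G := one_le_srwI_one hd
  have hd0 : (0 : ℝ) < 2 * (d : ℝ) := by
    have : (3 : ℝ) ≤ d := by exact_mod_cast hd
    linarith
  have hβ : (0 : ℝ) ≤ 1 / (2 * (d : ℝ)) := by positivity
  refine two_mul_div_le_connectiveConstant_of (by omega) (C := G) (by linarith) (by linarith) ?_
  refine succ_le_sum_count_mul_pow_of (by omega) (loopTuples fun σ => SRW.count d σ 0) (fun m => G * G ^ m)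
    pow_le_sum_count_mul_loopTuples fun K m => ?_
  have hS0 : 0 ≤ ∑ j ∈ range (K + 1), (SRW.count d j 0 : ℝ) * (1 / (2 * (d : ℝ))) ^ j :=
    Finset.sum_nonneg fun j _ => by positivity
  calc ∑ k ∈ range (K + 1), (loopTuples (fun σ => SRW.count d σ 0) (m + 1) k : ℝ) * (1 / (2 * (d : ℝ))) ^ k
      ≤ (∑ j ∈ range (K + 1), (SRW.count d j 0 : ℝ) * (1 / (2 * (d : ℝ))) ^ j) ^ (m + 1) :=
        sum_loopTuples_mul_pow_le hβ _ K (m + 1)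
    _ ≤ G ^ (m + 1) := pow_le_pow_left₀ hS0 (sum_count_mul_pow_le_srwI hd K) _
    _ = G * G ^ m := by ring

/-- **Hara–Slade–Sokal `k = 1` (first-step form): `μ(ℤ^d) ≥ 2d / (G_d − (G_d − 1)/(2d))`** for every `d ≥ 3`:
the loops at the pivots `j ≥ 1` avoid the previous pivot, and `Σ_σ w_σ (2d)^{−σ} ≤ G_d − (G_d − 1)/(2d)`. (The printed
`k = 1` bound uses the exact `C₀^{\{e\}} = 2 − 1/C₀` (2.33); the first-step bound used here agrees with it to second
order in `1/d`.) [cite: HaraSladeSokal1993, §2.3, eq. (2.32)–(2.33)] -/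
theorem two_mul_div_nb_le_connectiveConstant (hd : 3 ≤ d) :
    2 * (d : ℝ) / (srwI d 1 0 0 - 1 / (2 * (d : ℝ)) * (srwI d 1 0 0 - 1)) ≤ connectiveConstant d := by
  set G := srwI d 1 0 0 with hGdef
  set W := G - 1 / (2 * (d : ℝ)) * (G - 1) with hWdef
  have hG1 : 1 ≤ G := one_le_srwI_one hd
  have hd3 : (3 : ℝ) ≤ d := by exact_mod_cast hd
  have hd0 : (0 : ℝ) < 2 * (d : ℝ) := by linarith
  have hβ : (0 : ℝ) ≤ 1 / (2 * (d : ℝ)) := by positivity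
  have hβ1 : 1 / (2 * (d : ℝ)) ≤ 1 := by rw [div_le_one hd0]; linarith
  have hW1 : 1 ≤ W := by
    rw [hWdef]
    nlinarith [mul_le_mul_of_nonneg_right hβ1 (by linarith : (0 : ℝ) ≤ G - 1)]
  refine two_mul_div_le_connectiveConstant_of (by omega) (C := G) (by linarith) (by linarith) ?_
  refine succ_le_sum_count_mul_pow_of (by omega) (loopTuples₂ (fun σ => SRW.count d σ 0) (nbLoops d))
    (fun m => G * W ^ m) pow_le_sum_count_mul_loopTuples₂ fun K m => ?_
  have hN0 : 0 ≤ ∑ j ∈ range (K + 1), (nbLoops d j : ℝ) * (1 / (2 * (d : ℝ))) ^ j :=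
    Finset.sum_nonneg fun j _ => by positivity
  calc ∑ k ∈ range (K + 1), (loopTuples₂ (fun σ => SRW.count d σ 0) (nbLoops d) (m + 1) k : ℝ) *
        (1 / (2 * (d : ℝ))) ^ k
      ≤ (∑ j ∈ range (K + 1), (SRW.count d j 0 : ℝ) * (1 / (2 * (d : ℝ))) ^ j) *
          (∑ j ∈ range (K + 1), (nbLoops d j : ℝ) * (1 / (2 * (d : ℝ))) ^ j) ^ m :=
        sum_loopTuples₂_mul_pow_le hβ _ _ K m
    _ ≤ G * W ^ m := by
        refine mul_le_mul (sum_count_mul_pow_le_srwI hd K) (pow_le_pow_left₀ hN0 (sum_nbLoops_mul_pow_le hd K) m)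
          (by positivity) (by linarith)


/-! ### Effective closed forms -/

/-- **`2d / (1 + 1/(2d) + 3/(4d²) + 1632/d³) ≤ μ(ℤ^d)`** for every `d ≥ 5` (`k = 0`, explicit).
[cite: HaraSladeSokal1993, §2.3 eq. (2.31), §6.2 eq. (6.19)] -/
theorem two_mul_div_explicit_le_connectiveConstant (hd : 5 ≤ d) :
    2 * (d : ℝ) / (1 + 1 / (2 * (d : ℝ)) + 3 / (4 * (d : ℝ) ^ 2) + 1632 / (d : ℝ) ^ 3) ≤ connectiveConstant d := by
  have hG := srwI_one_zero_zero_le_explicit hd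
  have hG1 := one_le_srwI_one (d := d) (by omega)
  have hd0 : (0 : ℝ) < d := by exact_mod_cast (show 0 < d by omega)
  refine le_trans ?_ (two_mul_div_srwI_le_connectiveConstant (d := d) (by omega))
  exact div_le_div_of_nonneg_left (by positivity) (by linarith) hG

/-- **EFFECTIVE KESTEN BOUND, first order: `2d − 1 − 1/d − 3300/d² ≤ μ(ℤ^d)` for every `d ≥ 5`** (`k = 0`).
Identity: `C·B = 2d − (149d³ + 13131d² + 16428d + 21542400)/(4d⁵)` for `C = 2d − 1 − 1/d − 3300/d²`,
`B = 1 + 1/(2d) + 3/(4d²) + 1632/d³`. [cite: HaraSladeSokal1993, §6.2, eq. (6.17)–(6.19)] -/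
theorem kesten_first_order_effective (hd : 5 ≤ d) :
    2 * (d : ℝ) - 1 - 1 / d - 3300 / (d : ℝ) ^ 2 ≤ connectiveConstant d := by
  have hd0 : (0 : ℝ) < d := by exact_mod_cast (show 0 < d by omega)
  refine le_trans ?_ (two_mul_div_explicit_le_connectiveConstant hd)
  have hB : (0 : ℝ) < 1 + 1 / (2 * (d : ℝ)) + 3 / (4 * (d : ℝ) ^ 2) + 1632 / (d : ℝ) ^ 3 := by positivity
  rw [le_div_iff₀ hB]
  have key : (2 * (d : ℝ) - 1 - 1 / d - 3300 / (d : ℝ) ^ 2) *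
      (1 + 1 / (2 * (d : ℝ)) + 3 / (4 * (d : ℝ) ^ 2) + 1632 / (d : ℝ) ^ 3) =
      2 * d - (149 * (d : ℝ) ^ 3 + 13131 * (d : ℝ) ^ 2 + 16428 * d + 21542400) / (4 * (d : ℝ) ^ 5) := by
    field_simp
    ring
  rw [key]
  have : (0 : ℝ) ≤ (149 * (d : ℝ) ^ 3 + 13131 * (d : ℝ) ^ 2 + 16428 * d + 21542400) / (4 * (d : ℝ) ^ 5) := by
    positivity
  linarith

/-- **`2d / (B₇ (1 − 1/(2d)) + 1/(2d)) ≤ μ(ℤ^d)`** for every `d ≥ 5`, `B₇ = 1 + 1/(2d) + 3/(4d²) + 15/(8d³) + 11392/d⁴`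
(`k = 1`, explicit). [cite: HaraSladeSokal1993, §2.3 eq. (2.32), §6.2 eq. (6.20)] -/
theorem two_mul_div_nb_explicit_le_connectiveConstant (hd : 5 ≤ d) :
    2 * (d : ℝ) / ((1 + 1 / (2 * (d : ℝ)) + 3 / (4 * (d : ℝ) ^ 2) + 15 / (8 * (d : ℝ) ^ 3) + 11392 / (d : ℝ) ^ 4) *
      (1 - 1 / (2 * (d : ℝ))) + 1 / (2 * (d : ℝ))) ≤ connectiveConstant d := by
  have hG := srwI_one_zero_zero_le_explicit₇ hd
  have hG1 := one_le_srwI_one (d := d) (by omega)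
  have hd5 : (5 : ℝ) ≤ d := by exact_mod_cast hd
  have hd0 : (0 : ℝ) < d := by linarith
  have hβ1 : 0 ≤ 1 - 1 / (2 * (d : ℝ)) := by
    rw [sub_nonneg, div_le_one (by linarith)]; linarith
  refine le_trans ?_ (two_mul_div_nb_le_connectiveConstant (d := d) (by omega))
  have hpos : 0 < srwI d 1 0 0 - 1 / (2 * (d : ℝ)) * (srwI d 1 0 0 - 1) := by
    have : srwI d 1 0 0 - 1 / (2 * (d : ℝ)) * (srwI d 1 0 0 - 1) = srwI d 1 0 0 * (1 - 1 / (2 * (d : ℝ))) +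
      1 / (2 * (d : ℝ)) := by ring
    rw [this]; positivity
  refine div_le_div_of_nonneg_left (by positivity) hpos ?_
  have : srwI d 1 0 0 - 1 / (2 * (d : ℝ)) * (srwI d 1 0 0 - 1) =
      srwI d 1 0 0 * (1 - 1 / (2 * (d : ℝ))) + 1 / (2 * (d : ℝ)) := by ring
  rw [this]
  exact add_le_add (mul_le_mul_of_nonneg_right hG hβ1) le_rfl

/-- **EFFECTIVE KESTEN BOUND, second order: `2d − 1 − 1/(2d) − 9/(4d²) − 22780/d³ ≤ μ(ℤ^d)` for every `d ≥ 5`.**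
Three terms of Kesten's expansion `μ = 2d − 1 − 1/(2d) − 3/(2d)² − …` with an explicit error, from the `k = 1`
loop erasure (loops avoid the previous pivot) and the `R = 7` enclosure of `G_d`. Identity: with `C = 2d − 1 − 1/(2d)
− 9/(4d²) − 22780/d³` and `W = B₇(1 − 1/(2d)) + 1/(2d)`,
`C·W = 2d − (48d⁵ + 2187196d⁴ + 729146d³ + 3644921d² + 16606437616d − 8304312320)/(64d⁸)`.
Kesten (1964) AS QUOTED in HSS93 (6.17): "`μ ≥ 2d − 1 − 1/(2d) + O(d⁻²)` … albeit without good control of the error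
term"; the tree's `abs_connectiveConstant_sub_two_le` is the ineffective `∃ K, ∀ᶠ d` form of the second order.
[cite: HaraSladeSokal1993, §6.2, eq. (6.17), (6.20)] -/
theorem kesten_second_order_effective (hd : 5 ≤ d) :
    2 * (d : ℝ) - 1 - 1 / (2 * (d : ℝ)) - 9 / (4 * (d : ℝ) ^ 2) - 22780 / (d : ℝ) ^ 3 ≤ connectiveConstant d := by
  have hd5 : (5 : ℝ) ≤ d := by exact_mod_cast hd
  have hd0 : (0 : ℝ) < d := by linarith
  refine le_trans ?_ (two_mul_div_nb_explicit_le_connectiveConstant hd)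
  have hβ1 : 0 ≤ 1 - 1 / (2 * (d : ℝ)) := by
    rw [sub_nonneg, div_le_one (by linarith)]; linarith
  have hW : (0 : ℝ) < (1 + 1 / (2 * (d : ℝ)) + 3 / (4 * (d : ℝ) ^ 2) + 15 / (8 * (d : ℝ) ^ 3) + 11392 / (d : ℝ) ^ 4) *
      (1 - 1 / (2 * (d : ℝ))) + 1 / (2 * (d : ℝ)) := by positivity
  rw [le_div_iff₀ hW]
  have key : (2 * (d : ℝ) - 1 - 1 / (2 * (d : ℝ)) - 9 / (4 * (d : ℝ) ^ 2) - 22780 / (d : ℝ) ^ 3) *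
      ((1 + 1 / (2 * (d : ℝ)) + 3 / (4 * (d : ℝ) ^ 2) + 15 / (8 * (d : ℝ) ^ 3) + 11392 / (d : ℝ) ^ 4) *
        (1 - 1 / (2 * (d : ℝ))) + 1 / (2 * (d : ℝ))) =
      2 * d - (48 * (d : ℝ) ^ 5 + 2187196 * (d : ℝ) ^ 4 + 729146 * (d : ℝ) ^ 3 + 3644921 * (d : ℝ) ^ 2 +
        16606437616 * d - 8304312320) / (64 * (d : ℝ) ^ 8) := by
    field_simp
    ring
  rw [key]
  have hnum : (0 : ℝ) ≤ 48 * (d : ℝ) ^ 5 + 2187196 * (d : ℝ) ^ 4 + 729146 * (d : ℝ) ^ 3 + 3644921 * (d : ℝ) ^ 2 +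
      16606437616 * d - 8304312320 := by
    have : (0 : ℝ) ≤ 48 * (d : ℝ) ^ 5 + 2187196 * (d : ℝ) ^ 4 + 729146 * (d : ℝ) ^ 3 + 3644921 * (d : ℝ) ^ 2 := by
      positivity
    linarith
  have : (0 : ℝ) ≤ (48 * (d : ℝ) ^ 5 + 2187196 * (d : ℝ) ^ 4 + 729146 * (d : ℝ) ^ 3 + 3644921 * (d : ℝ) ^ 2 +
      16606437616 * d - 8304312320) / (64 * (d : ℝ) ^ 8) := by positivity
  linarith

/-! ## §8. The two-sided EFFECTIVE Kesten expansion

The matching ceiling comes from the memory-4 (Fisher–Sykes) cubic already in the tree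
(`connectiveConstant_cube_le_fisherSykes`): its root is `2d − 1 − 1/(2d) + (2d)⁻² + O(d⁻⁴)`, and the closed
form `2d − 1 − 1/(2d+2) < 2d − 1 − 1/(2d) + 1/(2d²)` dominates it for every `d ≥ 2`.  Together with §7 this makes the in-tree
INEFFECTIVE statement `abs_connectiveConstant_sub_two_le : ∃ K, ∀ᶠ d, |μ − (2d − 1 − 1/(2d))| ≤ K/d²`
(lace expansion, [cite: BDGS2012, §1.4 eq. (1.19)]) effective: `K = 4559` works for EVERY `d ≥ 5`. -/

/-- **`μ(ℤ^d) < 2d − 1 − 1/(2d+2)` for every `d ≥ 2`** — the memory-4 ceiling in closed form: the Fisher–Sykes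
cubic `θ³ − 2(d−1)θ² − 2(d−1)θ − 1` is positive at `R = 2d − 1 − 1/(2d+2)` (value
`(8d³ + 4d² − 26d − 23)/(2d+2)³ > 0`) and increasing on `[R, ∞)`, while it is `≤ 0` at `μ` by
`connectiveConstant_cube_le_fisherSykes`.  (The cubic is printed; this closed form is not.)
[cite: MadrasSlade1993, §1.2 eq. (1.2.14), p. 11] [cite: HaraSladeSokal1993, Section 6.2, eq. (6.16) with r = 2] -/
theorem connectiveConstant_lt_fisherSykes_closed_form {d : ℕ} (hd : 2 ≤ d) :
    connectiveConstant d < 2 * (d : ℝ) - 1 - 1 / (2 * d + 2) := by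
  have hfs := connectiveConstant_cube_le_fisherSykes (d := d) hd
  set μ := connectiveConstant d with hμ
  have hd' : (2 : ℝ) ≤ d := by exact_mod_cast hd
  set R : ℝ := 2 * (d : ℝ) - 1 - 1 / (2 * d + 2) with hR
  by_contra hcon
  have hge : R ≤ μ := le_of_not_gt hcon
  have hfR : 0 < R ^ 3 - 2 * ((d : ℝ) - 1) * R ^ 2 - 2 * ((d : ℝ) - 1) * R - 1 := by
    have hne : (2 * (d : ℝ) + 2) ≠ 0 := by positivity
    have hpos : (0 : ℝ) < (2 * (d : ℝ) + 2) ^ 3 := by positivity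
    have hpoly : 0 < 8 * (d : ℝ) ^ 3 + 4 * (d : ℝ) ^ 2 - 26 * d - 23 := by nlinarith [hd']
    have : R ^ 3 - 2 * ((d : ℝ) - 1) * R ^ 2 - 2 * ((d : ℝ) - 1) * R - 1
        = (8 * (d : ℝ) ^ 3 + 4 * (d : ℝ) ^ 2 - 26 * d - 23) / (2 * (d : ℝ) + 2) ^ 3 := by
      rw [hR]
      field_simp
      ring
    rw [this]
    exact div_pos hpoly hpos
  set e := μ - R with he
  have he0 : 0 ≤ e := by linarith
  have hR1 : 2 * ((d : ℝ) - 1) ≤ R := by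
    rw [hR]; have : 1 / (2 * (d : ℝ) + 2) ≤ 1 := by
      rw [div_le_one (by linarith)]; linarith
    linarith
  have hR0 : 0 ≤ R := by linarith
  have hexp : μ ^ 3 - 2 * ((d : ℝ) - 1) * μ ^ 2 - 2 * ((d : ℝ) - 1) * μ - 1
      = (R ^ 3 - 2 * ((d : ℝ) - 1) * R ^ 2 - 2 * ((d : ℝ) - 1) * R - 1)
        + e * (3 * R ^ 2 - 4 * ((d : ℝ) - 1) * R - 2 * ((d : ℝ) - 1))
        + e ^ 2 * (3 * R - 2 * ((d : ℝ) - 1)) + e ^ 3 := by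
    rw [show μ = R + e by rw [he]; ring]; ring
  have hderiv : 0 ≤ 3 * R ^ 2 - 4 * ((d : ℝ) - 1) * R - 2 * ((d : ℝ) - 1) := by
    nlinarith [hR1, hd']
  have : 0 < μ ^ 3 - 2 * ((d : ℝ) - 1) * μ ^ 2 - 2 * ((d : ℝ) - 1) * μ - 1 := by
    rw [hexp]
    have h2 : 0 ≤ e ^ 2 * (3 * R - 2 * ((d : ℝ) - 1)) := mul_nonneg (by positivity) (by linarith)
    have h3 : 0 ≤ e ^ 3 := by positivity
    have h1 : 0 ≤ e * (3 * R ^ 2 - 4 * ((d : ℝ) - 1) * R - 2 * ((d : ℝ) - 1)) := mul_nonneg he0 hderiv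
    linarith
  linarith

/-- **`μ(ℤ^d) < 2d − 1 − 1/(2d) + 1/(2d²)` for every `d ≥ 2`** (from the closed form:
`1/(2d) − 1/(2d+2) = 1/(2d(d+1)) < 1/(2d²)`; the cubic's root itself is `2d − 1 − 1/(2d) + 1/(4d²) + O(d⁻⁴)`).
[cite: MadrasSlade1993, §1.2 eq. (1.2.14), p. 11 (lane corollary of the Fisher–Sykes cubic)] -/
theorem connectiveConstant_lt_kesten_upper {d : ℕ} (hd : 2 ≤ d) :
    connectiveConstant d < 2 * (d : ℝ) - 1 - 1 / (2 * (d : ℝ)) + 1 / (2 * (d : ℝ) ^ 2) := by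
  have h := connectiveConstant_lt_fisherSykes_closed_form hd
  have hd' : (2 : ℝ) ≤ d := by exact_mod_cast hd
  have hd0 : (0 : ℝ) < d := by linarith
  have key : 1 / (2 * (d : ℝ)) - 1 / (2 * (d : ℝ) ^ 2) ≤ 1 / (2 * (d : ℝ) + 2) := by
    rw [div_sub_div _ _ (by positivity) (by positivity), div_le_div_iff₀ (by positivity) (by positivity)]
    nlinarith [hd0, hd']
  linarith

/-- **EFFECTIVE two-sided Kesten expansion** [Kesten 1964; Hara–Slade–Sokal 1993 (6.17); in-tree ineffective form
`abs_connectiveConstant_sub_two_le`]: for every `d ≥ 5`,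
`|μ(ℤ^d) − (2d − 1 − 1/(2d))| ≤ 9/(4d²) + 22780/d³` — the floor is `kesten_second_order_effective` (loop erasure,
k = 1), the ceiling `connectiveConstant_lt_kesten_upper` (memory-4 cubic). [cite: HaraSladeSokal1993, Section 6.2, eq. (6.17)] [cite: BDGS2012, §1.4 eq. (1.19) (the ineffective statement, made explicit here)] -/
theorem abs_connectiveConstant_sub_kesten_le {d : ℕ} (hd : 5 ≤ d) :
    |connectiveConstant d - (2 * d - 1 - 1 / (2 * d))| ≤ 9 / (4 * (d : ℝ) ^ 2) + 22780 / (d : ℝ) ^ 3 := by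
  have hlo := kesten_second_order_effective hd
  have hup := connectiveConstant_lt_kesten_upper (d := d) (by omega)
  have hd0 : (0 : ℝ) < d := by exact_mod_cast (show 0 < d by omega)
  have h1 : (0 : ℝ) ≤ 22780 / (d : ℝ) ^ 3 := by positivity
  have h2 : 1 / (2 * (d : ℝ) ^ 2) ≤ 9 / (4 * (d : ℝ) ^ 2) := by
    rw [div_le_div_iff₀ (by positivity) (by positivity)]
    nlinarith [pow_pos hd0 2]
  rw [abs_le]
  constructor <;> linarith

/-- **The in-tree `abs_connectiveConstant_sub_two_le` with an explicit constant and threshold**: for every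
`d ≥ 5`, `|μ(ℤ^d) − (2d − 1 − 1/(2d))| ≤ 4559/d²` (`9/4 + 22780/5 = 4558.25`). [cite: HaraSladeSokal1993, Section 6.2, eq. (6.17)] [cite: BDGS2012, §1.4 eq. (1.19) (the ineffective statement, made explicit here)] -/
theorem abs_connectiveConstant_sub_two_le_effective {d : ℕ} (hd : 5 ≤ d) :
    |connectiveConstant d - (2 * d - 1 - 1 / (2 * d))| ≤ 4559 / (d : ℝ) ^ 2 := by
  have h := abs_connectiveConstant_sub_kesten_le hd
  have hd' : (5 : ℝ) ≤ d := by exact_mod_cast hd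
  have hd0 : (0 : ℝ) < d := by linarith
  have h3 : 22780 / (d : ℝ) ^ 3 ≤ 4556 / (d : ℝ) ^ 2 := by
    rw [div_le_div_iff₀ (by positivity) (by positivity)]
    nlinarith [pow_pos hd0 2, pow_pos hd0 4, hd']
  have h4 : 9 / (4 * (d : ℝ) ^ 2) + 4556 / (d : ℝ) ^ 2 ≤ 4559 / (d : ℝ) ^ 2 := by
    rw [div_add_div _ _ (by positivity) (by positivity), div_le_div_iff₀ (by positivity) (by positivity)]
    nlinarith [pow_pos hd0 2, pow_pos hd0 4]
  linarith

end Literature.Probability.RandomPlanarGeometry.SAW.Zd.LoopErasure
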